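/-
Copyright: lit-balaban cell, Phase-2 proof seat p33 (gen 10).  Statement-level skeleton of a published paper; no proof claims beyond
what the kernel checks below.
-/
import Literature.MathematicalPhysics.QuantumFieldTheory.BalabanImbrieJaffe1984to88.BIJ85TkCovariance
import Literature.MathematicalPhysics.QuantumFieldTheory.BalabanImbrieJaffe1984to88.BIJ85SecClosedIdxAllToriTwo

/-!
# `BalabanImbrieJaffe1984to88.BIJ85LineSumReflection` — T. Bałaban, J. Imbrie, A. Jaffe, *Renormalization of the Higgs model:
minimizers, propagators and the stability of mean field theory*, Commun. Math. Phys. **97** (1985) 299–329 [BalabanImbrieJaffe1985],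
§7.3 p. 326: **the unit-bond line sums of the correction `T_kg = 𝒟_k∂*Q^{e*}_kg` of the second printed form of (7.3.2) are bounded
UNIFORMLY IN THE NUMBER OF SCALES `k`** on every two-dimensional torus, hypothesis-free — p11's located constant
`BIJ85Claim73SecondForm.SecClosedIdx.hT` holds with ONE `K_T` for all `k` (file 3/3 of the gen-10 member of SKELETON row
**C1.Eq7.3.1-7.3.2**, GAPS G-C1-05 ADDENDA 7–8 item (γ′); files 1–2: `BIJ85TorusReflections`, `BIJ85TkCovariance`).

statement-level skeleton of published theorems with citation tags; proofs where landed; nothing here is a claim about the Yang–Mills mass gap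

THE PRINTED TEXT.  p. 326 [PDF 28], verbatim: *"The second form of the inequality substitutes v_b for u_k(b) in the covariant derivative
of φ. These inequalities can be proved by an extension of the proofs of [7]."*  p09's `BIJ85LineSumTkBound` proved the line-sum
constant of this substitution only linearly in `k` (`K_T = K₀·k`, summing the absolute values of the (7.2.2)–(7.2.3) majorants scale by
scale; its HONEST SCOPE (ii) records that the k-uniform constant *"is NOT proved and is NECESSARY for the printed use of (7.3.2)"*).

THE ARGUMENT (reflection symmetry; every statement below is a theorem of this file).  Let `c = ⟨y′, μ⟩` be a unit bond of `T^{(k)}`,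
`x₀ = L^k·y′` the lowest corner of its block, `ℓ = {⟨x₀ + te_μ, μ⟩ : t < L^k}` its line of η-bonds, `ν ≠ μ`, and `S` the symmetry of
`T^{(0)}` reflecting through the hyperplane `{x_ν = (x₀)_ν − ½}` — the centre reflection `c_ν` of file 1 followed by the unit-lattice
translation by `2y′_νe_ν` (a symmetry of every level of the block geometry).  By file 2, `T_k(S^*g) = S^*(T_kg)`, and `S` maps `ℓ` onto
the parallel line `ℓ⁻ = ℓ − e_ν`; hence `Σ_ℓ T_k(S^*g) = Σ_{ℓ⁻} T_kg` (§4).  STOKES on the strip between `ℓ⁻` and `ℓ` (§3):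
`Σ_ℓ A − Σ_{ℓ⁻} A = (two ν-bond values) − Σ_{strip} (plaquette circulations of A)`, and for `A = T_kg` the circulation of an
η-plaquette is `η·[(Q^{e*}_kg)(p) − f_k(p)/√(η^d)]` with `f_k` the residual field (4.2.6) (p30's `resE`, `resE_apply`), bounded by
`K_R√(η^d)·max|g|` for closed `g` (p33's `exists_KR_allTori`); along the strip exactly ONE η-plaquette is an edge plaquette of
`B^e_k` (§2), so `η·|Σ_ℓ T_kg − Σ_{ℓ⁻} T_kg| ≤ (2K_∞ + 1 + K_R)·max|g|` with `K_∞` the POINTWISE constant `η|T_kg(b)| ≤ K_∞max|g|`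
(§5, geometric in the scale).  Therefore `2Σ_ℓ T_kg = Σ_ℓ T_k(g + S^*g) + O(max|g|/η)`, and the symmetrised field `g + S^*g` VANISHES
on every unit plaquette fixed by `S` with orientation reversed (§4) — in `d = 2` these are exactly the plaquettes whose edge
plaquettes come within `L^k − 1` of `ℓ` (§2: a plaquette NOT so fixed has all its edge plaquettes at sup-distance `≥ L^k − 1` from
every bond of `ℓ`).  For such FAR sources the scale-`j` majorant of p09 carries the extra factor `e^{−(a/3)(L^k−1)/L^j}`, whose sum
over `j < k` is bounded independently of `k` (§6).  Assembling (§7): `η·|Σ_ℓ T_kg| ≤ K_T·max|g|` with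
`K_T = K_far + K_∞ + (1 + K_R)/2` independent of `k`, of `L`-exponents and of the volume.

WHAT THIS FILE PROVES (0 `sorry`; no `def … : Prop`; standing range `k ≤ m + K`).
* §1 geometry of the k-corners: `val_cornerIter`, `cornerIter_eq_scaleTo` (`cornerIter k y = L^k·(B^k-point)`), `val_blockOfIter`.
* §2 the edge plaquettes of `B^e_k(p)`: their labels (`val_src_of_mem_edgeB`: offset `L^k − 1` in both directions of `p`), the torus
  distance lemma `le_cdist_of_ne`, and, `d = 2`, **`le_supDist_of_mem_edgeB_two`**: a unit plaquette `p` with `p₋,ν ≠ y′_ν − 1` has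
  all its edge plaquettes at sup-distance `≥ L^k − 1` from the line; **`abs_sum_QestarIter_strip_le`**: along the strip below the line
  `Q^{e*}_kg` is supported on one η-plaquette.
* §3 the strip Stokes identity `sum_runBond_shift_eq` and `curl_TkF_eq` (`∂(T_kg) = Q^{e*}_kg − f_k/√(η^d)` componentwise);
  **`eta_abs_strip_le`**.
* §4 the symmetry `S = c_ν ∘ τ_{2y′_νe_ν}` (`symVec`, `crefl_add_symVec`): `TkF_symm` (`T_kS^* = S^*T_k`, files 1–2),
  `sum_runBond_symm` (`Σ_ℓ S^*A = Σ_{ℓ⁻} A`), `symm_apply_of_fixed` (`S^*g = −g` on the `S`-fixed plaquettes containing `ν`),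
  **`far_of_symm_two`** (`d = 2`: every source of `g + S^*g` is far from the line).
* §5 **`eta_abs_TkF_le_two`**: the pointwise bound `η|T_kg(b)| ≤ K_∞·max|g|` (`d = 2`, from p09's `abs_term_le`).
* §6 **`eta_abs_sum_TkF_far_le_two`**: the far-source line-sum bound, uniform in `k` (`d = 2`).
* §7 **`eta_abs_lineSumIter_TkF_le_uniform`** (per torus, given (7.2.2)–(7.2.3), `0 ≤ M_C` and the residual bound;
  `isClosedPlaq_of_two`: every `g` is closed in `d = 2`) and, HYPOTHESIS-FREE,
  **`exists_KT_uniform_allTori`**: for every odd `L > 1` ONE `K_T ≥ 0` with `η·|Σ_{b′⊂c}(T_kg)_{b′}| ≤ K_T·max|g|` for ALL tori with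
  `d = 2`, `P.L = L`, ALL `k ≤ m + K`, all `g`, all unit bonds; **`secClosedIdx_allTori_two_uniform`**: p11's `SecClosedIdx 2 K_R K_T 𝓅`
  is total over the actual Sect. 7.3 data of every two-dimensional torus at ONE `(K_R, K_T)`.
HONEST SCOPE.  (i) `d = 2` only (p09's (ii) corrected there; its (i), the divergence of the absolute majorant in `d ≥ 3` near the
line, is untouched: in `d ≥ 3` the symmetrisation over all `ν ≠ μ` removes the near sources as well — §2's distance lemma is stated for
`d = 2` only — and the residual bound needs closed `g`, which is automatic only in `d = 2`).  (ii) Constants explicit, far from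
optimal; `U = 1`, real fields, torus, standing range, operators OF RECORD (`HkE`, `CE`, `DkE`, `QesOp`, `TkF`).  (iii) The
symmetry used is that of the TREE's operators (centred blocks and centred axial trees of `Setup` / `LatticeFieldCalculus.IsAxial`);
nothing printed is contradicted and no typed slot is altered: the result instantiates p11's `SecClosedIdx.hT` VERBATIM with a
k-independent `K_T`, which is what the printed use of (7.3.2) at the last step requires (GAPS G-C1-05 ADD. 7).

CITATION HEADER (lean-in-tree rule).  Phase-2 file of the lit-balaban TYPED SKELETON (HOME `run/shared/lean/pub/lit-balaban/`), seat
p33 gen 10 (unit `lit-balaban-p33-g10`; TAKING line HOME/STATUS.md 2026-08-22T03:08Z; owner r15, referee ref-5).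
-/

open scoped BigOperators RealInnerProductSpace
open Finset

namespace Literature.MathematicalPhysics.QuantumFieldTheory.BalabanImbrieJaffe1984to88.BIJ85LineSumReflection

open Literature.MathematicalPhysics.QuantumFieldTheory.Balaban1983to89 hiding Site Plaq
open Balaban1983to89.LatticeFieldCalculus hiding runSite runBond runSite_zero
open Balaban1983to89.B3TorusRadialSums (cdist cdist_le_supDist exists_int_of_cdist_le supDist_comm)
open Balaban1983to89.B5Eq118OneStroke (iterBlockOf val_iterBlockOf)
open Balaban1983to89.B7SectAStatements (blockOfIter blockOfIter_zero blockOfIter_succ)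
open BIJ85AxialPropagator411 (BondSpace toE curlOp)
open BIJ85Prop521Torus (CoarseSpace toEj)
open BIJ85Prop522Torus (HkE CE DkE)
open BIJ85Sigma421Torus (UnitPlaqSpace toU QesOp)
open BIJ85Sigma422Eta (eta_pos eta_inv)
open BIJ85CellAverages (Cells)
open BIJ85Eq224Base0 (torusEdgeCellsTo QestarIter_eq)
open BIJ85Eq531Inputs (QestarIter)
open BIJ85BlockAveragesTorus (corner val_corner runSite runBond runSite_zero runSite_shift)
open BIJ85BlockAveragesTorusK (cornerIter cornerIter_zero cornerIter_succ)
open BIJ85Ineq732SecondForm (lineSumIter)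
open BIJ88Eq541Base0 (TkF)
open BIJ85LineSumTkKernel (lineSumIter_eq_sum_runBond TkF_eq_triple_sum)
open BIJ85LineSumTkBound (runSite_apply_self sum_line_exp_le exp_worst_le abs_term_le)
open BIJ85Sect7Statements BIJ85Ineq722Torus
open BIJ85Ineq722DeltaA (deltaAData)
open BIJ88Decay216Torus (supDist_ctr_le_of_mem sum_exp_neg_distEU_le iterBlockOf_eq_of_mem_edgeB)
open BIJ85Sect72AllToriHolds (exists_absH_le_allTori exists_gradB_allTori)
open BIJ85Sect72AllTori (abs_H_zero_le)
open BIJ85Ineq723TorusCE (ineq723_CE)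
open BIJ85Eq454PlaqResidual (resE resE_apply eta_mul_L_pow)
open BIJ85Claim73AllTori (exists_KR_allTori closedIdx_allTori)
open BIJ85UnitTorusHodge (IsClosedPlaq isClosedPlaq_iff_cube)
open BIJ85Claim73Closed (ClosedIdx)
open BIJ85Claim73SecondForm (SecClosedIdx)
open BIJ85Sect1Model (U1Field)
open BIJ88Sect2TranslInvTorus (scaleTo_apply)
open Balaban1983to89 renaming Site → TSite, Plaq → TPlaq

noncomputable section

variable {P : Params}

/-! ## §1  Geometry of the k-corners -/

/-- kernel: `0 < L^n`. [folklore] -/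
private theorem cast_pow_L_pos' (n : ℕ) : (0 : ℝ) < (P.L : ℝ) ^ n := pow_pos P.cast_L_pos n

/-- kernel: every torus of the series has at least two sites per direction. [cite: BalabanImbrieJaffe1985, (2.1) p.302] -/
theorem two_le_sitesPerDir (j : ℕ) : 2 ≤ P.sitesPerDir j := by
  unfold Params.sitesPerDir
  exact Nat.le_mul_of_pos_right 2 (pow_pos P.L_pos _)

/-- kernel: the label of `L^k·t` is `L^k` times the label of `t` (r18's `scaleTo_apply`; `k ≤ m + K`). [cite: BalabanImbrieJaffe1985, (2.1) p.302] -/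
theorem val_scaleTo {k : ℕ} (hk : k ≤ P.m + P.K) (t : TSite P k) (μ : Fin P.d) :
    (Site.scaleTo k t μ).val = (t μ).val * P.L ^ k := by
  rw [scaleTo_apply hk, ZMod.val_natCast, Nat.mod_eq_of_lt]
  rw [sitesPerDir_zero_eq hk]
  exact mul_lt_mul_of_pos_right (ZMod.val_lt _) (pow_pos P.L_pos k)

/-- kernel: the label of the lowest corner `cornerIter k y` of the k-block of `y` is `L^k` times the label of `y` (`k ≤ m + K`).
[cite: BalabanImbrieJaffe1985, (5.1.2) p.313] -/
theorem val_cornerIter : ∀ (k : ℕ) (_ : k ≤ P.m + P.K) (y : TSite P (0 + k)) (μ : Fin P.d),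
    (cornerIter k y μ).val = (y μ).val * P.L ^ k
  | 0, _, y, μ => by simp
  | k + 1, hk, y, μ => by
    rw [cornerIter_succ, val_cornerIter k (by omega) (corner y) μ, val_corner (by show 0 + k + 1 ≤ P.m + P.K; omega) y μ,
      pow_succ]
    ring

/-- **the lowest corner of a unit bond is `L^k` times its k-fold block point**: `cornerIter k y = L^k·(B^k-point of cornerIter k y)`
(`Site.scaleTo`, `iterBlockOf`; `k ≤ m + K`) — the form in which the translation covariance of file 2 applies to the lines of (7.3.2).
[cite: BalabanImbrieJaffe1985, (5.1.2) p.313] -/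
theorem cornerIter_eq_scaleTo {k : ℕ} (hk : k ≤ P.m + P.K) (y : TSite P (0 + k)) :
    cornerIter k y = Site.scaleTo k (iterBlockOf k (cornerIter k y)) := by
  funext μ
  apply ZMod.val_injective
  rw [val_scaleTo hk, val_iterBlockOf k hk, val_cornerIter k hk, Nat.mul_div_cancel _ (pow_pos P.L_pos k)]

/-- kernel: the label of the k-fold block point of the named-level geometry (`blockOfIter k : T^{(0)} → T^{(0+k)}`) is the label
integer-divided by `L^k` (`k ≤ m + K`). [cite: BalabanImbrieJaffe1985, (2.24) p.305] -/
theorem val_blockOfIter : ∀ (k : ℕ) (_ : k ≤ P.m + P.K) (x : TSite P 0) (μ : Fin P.d),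
    ((blockOfIter k x) μ).val = (x μ).val / P.L ^ k
  | 0, _, x, μ => by simp
  | k + 1, hk, x, μ => by
    rw [blockOfIter_succ, Site.val_blockOf (by show 0 + k + 1 ≤ P.m + P.K; omega), val_blockOfIter k (by omega) x μ, pow_succ,
      Nat.div_div_eq_div_mul]

/-! ## §2  The edge plaquettes of `B^e_k(p)`: labels, distances to a line, the strip below a line -/

/-- kernel: if the `k`-fold block point of `x + e_μ` is the `μ`-neighbour of that of `x`, then `x` sits at offset `L^k − 1` in its
k-block (`k ≤ m + K`). [cite: BalabanImbrieJaffe1985, (2.21) p.305] -/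
theorem mod_eq_of_blockOfIter_shift {k : ℕ} (hk : k ≤ P.m + P.K) (x : TSite P 0) (μ : Fin P.d)
    (h : blockOfIter k (x.shift μ) = (blockOfIter k x).shift μ) : (x μ).val % P.L ^ k = P.L ^ k - 1 := by
  set T := P.L ^ k with hT
  have hT0 : 0 < T := pow_pos P.L_pos k
  set a := (x μ).val with ha
  set N' := P.sitesPerDir k with hN'
  have hN0 : P.sitesPerDir 0 = N' * T := sitesPerDir_zero_eq hk
  have h20 : 2 ≤ P.sitesPerDir 0 := two_le_sitesPerDir 0
  have h2k : 2 ≤ P.sitesPerDir (0 + k) := two_le_sitesPerDir (0 + k)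
  have haN : a < N' * T := by rw [← hN0]; exact ZMod.val_lt _
  set qv := a / T with hqv
  set r := a % T with hr
  have hdm : T * qv + r = a := Nat.div_add_mod a T
  have hqN : qv < N' := Nat.div_lt_of_lt_mul (by rwa [mul_comm] at haN)
  have hrT : r < T := Nat.mod_lt a hT0
  by_contra hne
  have hlt : r + 1 < T := by omega
  -- the label of `x + e_μ` is `a + 1`
  have ha1 : a + 1 < P.sitesPerDir 0 := by
    rw [hN0]
    calc a + 1 = T * qv + r + 1 := by omega
      _ < T * qv + T := by omega
      _ = T * (qv + 1) := by ring
      _ ≤ T * N' := Nat.mul_le_mul_left T hqN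
      _ = N' * T := mul_comm _ _
  have hone : (1 : ZMod (P.sitesPerDir 0)).val = 1 := by
    rw [ZMod.val_one_eq_one_mod, Nat.mod_eq_of_lt (by omega)]
  have h1 : ((x.shift μ) μ).val = a + 1 := by
    rw [Site.shift_apply, if_pos rfl, ZMod.val_add_of_lt (by rw [hone]; exact ha1), hone]
  -- compare the `μ`-labels of the two sides of `h`
  have hL : ((blockOfIter k (x.shift μ)) μ).val = qv := by
    rw [val_blockOfIter k hk, h1, show a + 1 = r + 1 + T * qv by omega, Nat.add_mul_div_left _ _ hT0, Nat.div_eq_of_lt hlt,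
      zero_add]
  have hone' : (1 : ZMod (P.sitesPerDir (0 + k))).val = 1 := by
    rw [ZMod.val_one_eq_one_mod, Nat.mod_eq_of_lt (by omega)]
  have hbv : ((blockOfIter k x) μ).val = qv := val_blockOfIter k hk x μ
  have hR : (((blockOfIter k x).shift μ) μ).val = (qv + 1) % P.sitesPerDir (0 + k) := by
    rw [Site.shift_apply, if_pos rfl, ZMod.val_add, hbv, hone']
  have hqN' : qv < P.sitesPerDir (0 + k) := by rw [← hbv]; exact ZMod.val_lt _
  have heq : qv = (qv + 1) % P.sitesPerDir (0 + k) := by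
    have e : ((blockOfIter k (x.shift μ)) μ).val = (((blockOfIter k x).shift μ) μ).val := by rw [h]
    rwa [hL, hR] at e
  rcases Nat.lt_or_ge (qv + 1) (P.sitesPerDir (0 + k)) with hc | hc
  · rw [Nat.mod_eq_of_lt hc] at heq; omega
  · have hc' : qv + 1 = P.sitesPerDir (0 + k) := le_antisymm hqN' hc
    rw [hc', Nat.mod_self] at heq
    omega

/-- **the labels of an edge plaquette**: for `q ∈ B^e_k(p)` (p31's geometry `torusEdgeCellsTo P 0 k k` from `T^{(0)}`), in each of its
two directions `λ` the label of `q₋` is `((p₋)_λ + 1)L^k − 1` — the k-block of `q₋` is `p₋` (`iterBlockOf_eq_of_mem_edgeB`) and the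
offset is `L^k − 1` (*"whose bonds touch four distinct L-blocks"*; `k ≤ m + K`). [cite: BalabanImbrieJaffe1985, (2.21) p.305] -/
theorem val_src_of_mem_edgeB (hd : 2 ≤ P.d) {k : ℕ} (hk : k ≤ P.m + P.K) {p : TPlaq P k} {q : TPlaq P 0}
    (h : q ∈ (torusEdgeCellsTo P 0 k k (Nat.zero_add k) hd).B p) {lam : Fin P.d} (hl : lam = q.μ ∨ lam = q.ν) :
    (q.src lam).val + 1 = ((p.src lam).val + 1) * P.L ^ k := by
  have hblk : (q.src lam).val / P.L ^ k = (p.src lam).val := by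
    rw [← val_iterBlockOf k hk q.src lam, iterBlockOf_eq_of_mem_edgeB hd h]
  have hc : blockOfIter k (q.src.shift q.μ) = (blockOfIter k q.src).shift q.μ ∧
      blockOfIter k (q.src.shift q.ν) = (blockOfIter k q.src).shift q.ν := by
    rw [Cells.mem_B] at h
    dsimp only [torusEdgeCellsTo] at h
    split_ifs at h with hc
    exact hc
  have hmod : (q.src lam).val % P.L ^ k = P.L ^ k - 1 := by
    rcases hl with rfl | rfl
    · exact mod_eq_of_blockOfIter_shift hk q.src _ hc.1
    · exact mod_eq_of_blockOfIter_shift hk q.src _ hc.2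
  have hT : 1 ≤ P.L ^ k := Nat.one_le_pow _ _ P.L_pos
  have hdm := Nat.div_add_mod (q.src lam).val (P.L ^ k)
  rw [hblk, hmod] at hdm
  calc (q.src lam).val + 1 = P.L ^ k * (p.src lam).val + (P.L ^ k - 1) + 1 := by rw [hdm]
    _ = ((p.src lam).val + 1) * P.L ^ k := by
      rw [add_mul, one_mul, mul_comm, add_assoc, Nat.sub_add_cancel hT]

/-- **the torus-distance lemma**: on `ZMod(|T^{(k)}|·L^k)` a label `yL^k` (a site at offset `0` of the k-block `y`) and a label
`(s+1)L^k − 1` (offset `L^k − 1` of the k-block `s`) are at circular distance `≥ L^k − 1` unless `s = y − 1` in `T^{(k)}`.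
[cite: BalabanImbrieJaffe1985, (7.2.2) p.325] -/
theorem le_cdist_of_ne {k : ℕ} (hk : k ≤ P.m + P.K) {u w : ZMod (P.sitesPerDir 0)} {y s : ZMod (P.sitesPerDir k)}
    (hu : u.val = y.val * P.L ^ k) (hw : w.val + 1 = (s.val + 1) * P.L ^ k) (hne : s ≠ y - 1) :
    P.L ^ k - 1 ≤ cdist (u - w) := by
  set T := P.L ^ k with hT
  have hT1 : 1 ≤ T := Nat.one_le_pow _ _ P.L_pos
  have hN0 : P.sitesPerDir 0 = P.sitesPerDir k * T := sitesPerDir_zero_eq hk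
  rcases Nat.lt_or_ge T 2 with hT2 | hT2
  · omega
  refine le_of_not_gt fun hlt => ?_
  obtain ⟨z, hz, hzc⟩ := exists_int_of_cdist_le (u - w) (T - 2) (by omega)
  rw [Finset.mem_Icc, Nat.cast_sub hT2] at hz
  push_cast at hz
  -- `z ≡ u − w (mod N'T)` as integers
  have hdvd : ((P.sitesPerDir 0 : ℕ) : ℤ) ∣ z - ((u.val : ℤ) - (w.val : ℤ)) := by
    rw [← ZMod.intCast_zmod_eq_zero_iff_dvd]
    push_cast
    rw [ZMod.natCast_zmod_val, ZMod.natCast_zmod_val, hzc, sub_self]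
  obtain ⟨c, hc⟩ := hdvd
  have hN0Z : ((P.sitesPerDir 0 : ℕ) : ℤ) = (P.sitesPerDir k : ℤ) * (T : ℤ) := by rw [hN0]; push_cast; ring
  rw [hN0Z] at hc
  have huZ : (u.val : ℤ) = (y.val : ℤ) * T := by exact_mod_cast hu
  have hwZ : (w.val : ℤ) = ((s.val : ℤ) + 1) * T - 1 := by
    have h := congrArg (Nat.cast : ℕ → ℤ) hw
    push_cast at h
    linarith
  set m' : ℤ := (y.val : ℤ) - s.val - 1 + c * (P.sitesPerDir k : ℤ) with hm'
  have hzm : z = m' * (T : ℤ) + 1 := by rw [hm']; linear_combination hc + huZ - hwZ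
  have hTpos : (0 : ℤ) < T := by exact_mod_cast hT1
  rcases lt_trichotomy m' 0 with hm | hm | hm
  · have h1 : m' * (T : ℤ) ≤ -1 * T := mul_le_mul_of_nonneg_right (by omega) hTpos.le
    have : z ≤ -(T : ℤ) + 1 := by rw [hzm]; linarith
    linarith [hz.1]
  · -- `m' = 0`: then `s = y − 1` in `T^{(k)}`
    rw [hm'] at hm
    have hd' : ((P.sitesPerDir k : ℕ) : ℤ) ∣ (y.val : ℤ) - s.val - 1 := ⟨-c, by linear_combination hm⟩
    have h0 : (((y.val : ℤ) - s.val - 1 : ℤ) : ZMod (P.sitesPerDir k)) = 0 :=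
      (ZMod.intCast_zmod_eq_zero_iff_dvd _ (P.sitesPerDir k)).2 hd'
    push_cast at h0
    rw [ZMod.natCast_zmod_val, ZMod.natCast_zmod_val] at h0
    exact hne (by linear_combination -h0)
  · have h1 : 1 * (T : ℤ) ≤ m' * T := mul_le_mul_of_nonneg_right (by omega) hTpos.le
    have : (T : ℤ) + 1 ≤ z := by rw [hzm]; linarith
    linarith [hz.2]

/-- kernel (`d = 2`): every direction is one of the two directions of every plaquette. [cite: BalabanImbrieJaffe1985, (2.20) p.305] -/
theorem dir_eq_or_eq_of_two (hd2 : P.d = 2) {j : ℕ} (q : TPlaq P j) (ν : Fin P.d) : ν = q.μ ∨ ν = q.ν := by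
  have h1 : (q.μ : ℕ) < q.ν := q.hμν
  have h2 : (q.ν : ℕ) < P.d := q.ν.isLt
  have h3 : (ν : ℕ) < P.d := ν.isLt
  have hd := hd2
  rcases Nat.eq_zero_or_pos (ν : ℕ) with h | h
  · left; exact Fin.ext (by omega)
  · right; exact Fin.ext (by omega)

/-- kernel: the sites of a `μ`-run keep their other coordinates. [cite: BalabanImbrieJaffe1985, (2.10) p.303] -/
theorem runSite_apply_of_ne {j : ℕ} (x : TSite P j) {μ ν : Fin P.d} (h : ν ≠ μ) (t : ℕ) : runSite x μ t ν = x ν := by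
  simp [runSite, Function.update_of_ne h]

/-- **FAR SOURCES (`d = 2`)**: for a unit plaquette `p` of `T^{(k)}` whose `ν`-row is NOT the row `y′_ν − 1` just below the block of
`y′`, every edge plaquette `q ∈ B^e_k(p)` lies at sup-distance `≥ L^k − 1` from every site of the `μ`-line through the corner `L^k·y′`
(`μ ≠ ν`, `k ≤ m + K`). [cite: BalabanImbrieJaffe1985, (7.2.2) p.325] -/
theorem le_supDist_of_mem_edgeB_two (hd : 2 ≤ P.d) (hd2 : P.d = 2) {k : ℕ} (hk : k ≤ P.m + P.K) (y' : TSite P k)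
    {μ ν : Fin P.d} (hμν : μ ≠ ν) {p : TPlaq P k} (hps : p.src ν ≠ y' ν - 1) {q : TPlaq P 0}
    (hq : q ∈ (torusEdgeCellsTo P 0 k k (Nat.zero_add k) hd).B p) (t : ℕ) :
    P.L ^ k - 1 ≤ supDist (runSite (Site.scaleTo k y') μ t) q.src := by
  have hxν : ((runSite (Site.scaleTo k y') μ t) ν).val = (y' ν).val * P.L ^ k := by
    rw [runSite_apply_of_ne _ hμν.symm, val_scaleTo hk]
  have hqν : (q.src ν).val + 1 = ((p.src ν).val + 1) * P.L ^ k := val_src_of_mem_edgeB hd hk hq (dir_eq_or_eq_of_two hd2 q ν)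
  exact (le_cdist_of_ne hk hxν hqν hps).trans (cdist_le_supDist _ _ ν)

/-- kernel: the circular coordinates of `Q^{e*}_k` (`|(Q^{e*}_kg)(p)| ≤ (L^k)²·max|g|`: an η-plaquette lies in at most one `B^e_k(p′)`,
(2.22) with `L^k` for `L`; `k ≤ m + K`). [cite: BalabanImbrieJaffe1985, (2.22) p.305] -/
theorem abs_QestarIter_le (hd : 2 ≤ P.d) {k : ℕ} (hk : k ≤ P.m + P.K) (g : TPlaq P k → ℝ) {C : ℝ} (hC : 0 ≤ C)
    (hg : ∀ q, |g q| ≤ C) (p : TPlaq P 0) : |QestarIter hd k g p| ≤ ((P.L : ℝ) ^ k) ^ 2 * C := by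
  rw [QestarIter_eq hd k hk]
  by_cases h : ∃ c, p ∈ (torusEdgeCellsTo P 0 k k (Nat.zero_add k) hd).B c
  · obtain ⟨c, hc⟩ := h
    rw [Cells.Qstar_of_mem _ _ hc, abs_mul]
    have e : (((torusEdgeCellsTo P 0 k k (Nat.zero_add k) hd).L : ℕ) : ℝ) ^ (torusEdgeCellsTo P 0 k k (Nat.zero_add k) hd).m =
        ((P.L : ℝ) ^ k) ^ 2 := by
      simp only [Nat.cast_pow]
    rw [e, abs_of_nonneg (by positivity)]
    exact mul_le_mul_of_nonneg_left (hg c) (by positivity)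
  · rw [Cells.Qstar_of_not_mem _ _ (fun c hc => h ⟨c, hc⟩), abs_zero]
    positivity

/-- The plaquette with lowest corner `x` in the (unordered) directions `μ ≠ ν`. [cite: BalabanImbrieJaffe1985, (2.20) p.305] -/
def plaqOf {j : ℕ} (x : TSite P j) {μ ν : Fin P.d} (h : μ ≠ ν) : TPlaq P j :=
  if hlt : μ < ν then ⟨x, μ, ν, hlt⟩ else ⟨x, ν, μ, lt_of_le_of_ne (not_lt.1 hlt) h.symm⟩

/-- `plaqOf` has lowest corner `x`. [cite: BalabanImbrieJaffe1985, (2.20) p.305] -/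
@[simp] theorem plaqOf_src {j : ℕ} (x : TSite P j) {μ ν : Fin P.d} (h : μ ≠ ν) : (plaqOf x h).src = x := by
  unfold plaqOf; split_ifs <;> rfl

/-- `μ` is a direction of `plaqOf x (h : μ ≠ ν)`. [cite: BalabanImbrieJaffe1985, (2.20) p.305] -/
theorem dir_mem_plaqOf {j : ℕ} (x : TSite P j) {μ ν : Fin P.d} (h : μ ≠ ν) : μ = (plaqOf x h).μ ∨ μ = (plaqOf x h).ν := by
  unfold plaqOf; split_ifs <;> simp

/-- **along the strip below the line only the last η-plaquette can be an edge plaquette**: for `x₀ = L^k·y′` and `t + 1 < L^k`,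
`(Q^{e*}_kg)(plaquette at x₀ − e_ν + te_μ in the directions μ, ν) = 0` (its `μ`-offset in the k-block is `t ≠ L^k − 1`; `k ≤ m + K`).
[cite: BalabanImbrieJaffe1985, (2.22) p.305] -/
theorem QestarIter_strip_eq_zero (hd : 2 ≤ P.d) {k : ℕ} (hk : k ≤ P.m + P.K) (y' : TSite P k) {μ ν : Fin P.d} (hμν : μ ≠ ν)
    (g : TPlaq P k → ℝ) {t : ℕ} (ht : t + 1 < P.L ^ k) :
    QestarIter hd k g (plaqOf (runSite ((Site.scaleTo k y').unshift ν) μ t) hμν) = 0 := by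
  set T := P.L ^ k with hT
  have hN0 : P.sitesPerDir 0 = P.sitesPerDir k * T := sitesPerDir_zero_eq hk
  rw [QestarIter_eq hd k hk]
  apply Cells.Qstar_of_not_mem
  intro c hc
  have h := val_src_of_mem_edgeB hd hk hc (dir_mem_plaqOf _ hμν)
  rw [plaqOf_src] at h
  -- the `μ`-label of the base point is `y′_μL^k + t`
  have hu : (Site.scaleTo k y' μ).val = (y' μ).val * T := val_scaleTo hk y' μ
  have htN : t < P.sitesPerDir 0 := by
    rw [hN0]
    exact lt_of_lt_of_le (by omega) (Nat.le_mul_of_pos_left T (by have := two_le_sitesPerDir (P := P) k; omega))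
  have htv : ((t : ℕ) : ZMod (P.sitesPerDir 0)).val = t := by rw [ZMod.val_natCast, Nat.mod_eq_of_lt htN]
  have hsum : (Site.scaleTo k y' μ).val + ((t : ℕ) : ZMod (P.sitesPerDir 0)).val < P.sitesPerDir 0 := by
    rw [hu, htv, hN0]
    calc (y' μ).val * T + t < (y' μ).val * T + T := by omega
      _ = ((y' μ).val + 1) * T := by ring
      _ ≤ P.sitesPerDir k * T := Nat.mul_le_mul_right _ (ZMod.val_lt _)
  have hv : ((runSite ((Site.scaleTo k y').unshift ν) μ t) μ).val = (y' μ).val * T + t := by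
    rw [runSite_apply_self, Site.unshift_apply, if_neg hμν, ZMod.val_add_of_lt hsum, hu, htv]
  rw [hv] at h
  -- reduce modulo `T`: `t ≡ T − 1`
  have hT1 : 1 ≤ T := Nat.one_le_pow _ _ P.L_pos
  have h1 : ((y' μ).val * T + t + 1) % T = (t + 1) % T := by rw [add_assoc, mul_comm, Nat.mul_add_mod]
  have h2 : (((c.src μ).val + 1) * T) % T = 0 := Nat.mul_mod_left _ _
  rw [h, h2, Nat.mod_eq_of_lt ht] at h1
  omega

/-- **the `Q^{e*}_k`-flux through the strip below the line is one term**: `|Σ_{t<L^k}(Q^{e*}_kg)(p_t)| ≤ (L^k)²·max|g|` for the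
η-plaquettes `p_t` at `L^k·y′ − e_ν + te_μ` (`μ ≠ ν`, `k ≤ m + K`). [cite: BalabanImbrieJaffe1985, (2.22) p.305] -/
theorem abs_sum_QestarIter_strip_le (hd : 2 ≤ P.d) {k : ℕ} (hk : k ≤ P.m + P.K) (y' : TSite P k) {μ ν : Fin P.d} (hμν : μ ≠ ν)
    (g : TPlaq P k → ℝ) {C : ℝ} (hC : 0 ≤ C) (hg : ∀ q, |g q| ≤ C) :
    |∑ t ∈ range (P.L ^ k), QestarIter hd k g (plaqOf (runSite ((Site.scaleTo k y').unshift ν) μ t) hμν)| ≤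
      ((P.L : ℝ) ^ k) ^ 2 * C := by
  have hT1 : 1 ≤ P.L ^ k := Nat.one_le_pow _ _ P.L_pos
  rw [Finset.sum_eq_single (P.L ^ k - 1)]
  · exact abs_QestarIter_le hd hk g hC hg _
  · intro t ht hne
    exact QestarIter_strip_eq_zero hd hk y' hμν g (by have := Finset.mem_range.1 ht; omega)
  · intro h
    exact absurd (Finset.mem_range.2 (by omega)) h

/-! ## §3  The strip Stokes identity and the residual field -/

/-- The circulation `A(∂p)` of a bond function around the plaquette with lowest corner `x` in the ORDERED directions `(μ, ν)`:
`A⟨x,μ⟩ + A⟨x+e_μ,ν⟩ − A⟨x+e_ν,μ⟩ − A⟨x,ν⟩` (`= c⁻¹·(∂A)(p)` up to the orientation sign). [cite: BalabanImbrieJaffe1985, (2.4) p.302] -/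
def circ {j : ℕ} (A : VecField P j ℝ) (x : TSite P j) (μ ν : Fin P.d) : ℝ :=
  A ⟨x, μ⟩ + A ⟨x.shift μ, ν⟩ - A ⟨x.shift ν, μ⟩ - A ⟨x, ν⟩

/-- `(∂A)(plaqOf x) = ±c·circ A x μ ν`, the sign being the orientation of `(μ, ν)`. [cite: BalabanImbrieJaffe1985, (2.4) p.302] -/
theorem curl_plaqOf {j : ℕ} (c : ℝ) (A : VecField P j ℝ) (x : TSite P j) {μ ν : Fin P.d} (h : μ ≠ ν) :
    curl c A (plaqOf x h) = (if μ < ν then c else -c) * circ A x μ ν := by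
  unfold plaqOf circ curl
  split_ifs
  · simp only [smul_eq_mul]
  · simp only [smul_eq_mul]; ring

/-- kernel: a `μ`-run from `z + e_ν` is the `e_ν`-translate of the run from `z` (`μ ≠ ν`). [cite: BalabanImbrieJaffe1985, (2.10) p.303] -/
theorem runSite_shift_of_ne {j : ℕ} (z : TSite P j) {μ ν : Fin P.d} (h : μ ≠ ν) (t : ℕ) :
    runSite (z.shift ν) μ t = (runSite z μ t).shift ν := by
  funext lam
  by_cases h1 : lam = μ
  · subst h1; simp [runSite, Site.shift_apply, h]
  · by_cases h2 : lam = ν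
    · subst h2; simp [runSite, Site.shift_apply, h1]
    · simp [runSite, Site.shift_apply, h1, h2]

/-- kernel: likewise for `z − e_ν`. [cite: BalabanImbrieJaffe1985, (2.10) p.303] -/
theorem runSite_unshift_of_ne {j : ℕ} (z : TSite P j) {μ ν : Fin P.d} (h : μ ≠ ν) (t : ℕ) :
    runSite (z.unshift ν) μ t = (runSite z μ t).unshift ν := by
  funext lam
  by_cases h1 : lam = μ
  · subst h1; simp [runSite, Site.unshift_apply, h]
  · by_cases h2 : lam = ν
    · subst h2; simp [runSite, Site.unshift_apply, h1]
    · simp [runSite, Site.unshift_apply, h1, h2]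

/-- **STOKES ON THE STRIP**: the sum of `A` along the run of `n` `μ`-bonds from `z + e_ν` equals the sum along the run from `z`, plus
the two `ν`-bond values closing the strip, minus the circulations around the `n` plaquettes of the strip.
[cite: BalabanImbrieJaffe1985, (2.4) p.302] -/
theorem sum_runBond_shift_eq {j : ℕ} (A : VecField P j ℝ) (z : TSite P j) {μ ν : Fin P.d} (hμν : μ ≠ ν) (n : ℕ) :
    ∑ t ∈ range n, A (runBond (z.shift ν) μ t) =
      ∑ t ∈ range n, A (runBond z μ t) + (A ⟨runSite z μ n, ν⟩ - A ⟨z, ν⟩) - ∑ t ∈ range n, circ A (runSite z μ t) μ ν := by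
  induction n with
  | zero => simp
  | succ n ih =>
    rw [Finset.sum_range_succ, Finset.sum_range_succ, Finset.sum_range_succ, ih]
    simp only [runBond, runSite_shift_of_ne z hμν, ← runSite_shift z μ n, circ]
    ring

/-- **`∂(T_kg) = Q^{e*}_kg − f_k/√(η^d)` componentwise** on the η-plaquettes, `f_k = (I − ∂G_{k,Ax}∂^*)Q^{e*}_kg` the residual field
(4.2.6) of p30 (`resE`, `resE_apply` through (5.2.10)); `∂ = curl (η⁻¹)`, `k ≤ m + K`. [cite: BalabanImbrieJaffe1985, (4.2.6) p.311] -/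
theorem curl_TkF_eq (hd : 2 ≤ P.d) {k : ℕ} (hk : k ≤ P.m + P.K) (g : TPlaq P k → ℝ) (p : TPlaq P 0) :
    curl (P.eta k)⁻¹ (TkF P hd ((P.eta k) ^ P.d) (P.eta k) k g) p =
      QestarIter hd k g p -
        (Real.sqrt ((P.eta k) ^ P.d))⁻¹ * resE hd ((P.eta k) ^ P.d) (P.eta k)⁻¹ k (toU P k g) p := by
  have hw : 0 < (P.eta k) ^ P.d := pow_pos (eta_pos P k) _
  have hc : (P.eta k)⁻¹ ≠ 0 := inv_ne_zero (eta_pos P k).ne'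
  have hs : Real.sqrt ((P.eta k) ^ P.d) ≠ 0 := (Real.sqrt_pos.2 hw).ne'
  have h := resE_apply hd hk hc hw (toU P k g) p
  have e1 : (fun q => toU P k g q) = g := rfl
  have e2 : WithLp.ofLp (DkE P ((P.eta k) ^ P.d) (P.eta k)⁻¹ k (LinearMap.adjoint (curlOp (P := P) ((P.eta k) ^ P.d) (P.eta k)⁻¹)
      (QesOp (P := P) hd ((P.eta k) ^ P.d) k (toU P k g)))) = TkF P hd ((P.eta k) ^ P.d) (P.eta k) k g := rfl
  rw [e1, e2] at h
  rw [h, ← mul_assoc, inv_mul_cancel₀ hs, one_mul, sub_sub_cancel]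

/-- **THE STRIP ESTIMATE**: for `A = T_kg` with the residual bound `|f_k| ≤ K_R√(η^d)·max|g|` and a pointwise bound
`η|A(b)| ≤ K_∞·max|g|`, the line sums of `A` over the line `ℓ` through `L^k·y′` and over `ℓ − e_ν` differ by at most
`(2K_∞ + 1 + K_R)·max|g|/η` (Stokes on the strip: two `ν`-bonds, one `Q^{e*}_k`-edge plaquette, `L^k` residuals; `k ≤ m + K`).
[cite: BalabanImbrieJaffe1985, (7.3.2) p.326] -/
theorem eta_abs_strip_le (hd : 2 ≤ P.d) {k : ℕ} (hk : k ≤ P.m + P.K) (y' : TSite P k) {μ ν : Fin P.d} (hμν : μ ≠ ν)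
    (g : TPlaq P k → ℝ) {C KR Kinf : ℝ} (hC : 0 ≤ C) (hg : ∀ q, |g q| ≤ C)
    (hR : ∀ p : TPlaq P 0, |resE hd ((P.eta k) ^ P.d) (P.eta k)⁻¹ k (toU P k g) p| ≤ KR * Real.sqrt ((P.eta k) ^ P.d) * C)
    (hinf : ∀ b : PBond P 0, P.eta k * |TkF P hd ((P.eta k) ^ P.d) (P.eta k) k g b| ≤ Kinf * C) :
    P.eta k * |∑ t ∈ range (P.L ^ k), TkF P hd ((P.eta k) ^ P.d) (P.eta k) k g (runBond (Site.scaleTo k y') μ t) -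
        ∑ t ∈ range (P.L ^ k), TkF P hd ((P.eta k) ^ P.d) (P.eta k) k g (runBond ((Site.scaleTo k y').unshift ν) μ t)| ≤
      (2 * Kinf + 1 + KR) * C := by
  set A := TkF P hd ((P.eta k) ^ P.d) (P.eta k) k g with hA
  set z := (Site.scaleTo k y').unshift ν with hz
  set T := P.L ^ k with hT
  set s := Real.sqrt ((P.eta k) ^ P.d) with hs
  set σ : ℝ := if μ < ν then (P.eta k)⁻¹ else -(P.eta k)⁻¹ with hσ
  have hη : 0 < P.eta k := eta_pos P k
  have hη1 : P.eta k ≤ 1 := by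
    rw [Params.eta]
    exact pow_le_one₀ (inv_nonneg.mpr (Nat.cast_nonneg _)) (inv_le_one_of_one_le₀ (by exact_mod_cast P.L_pos))
  have hw : 0 < (P.eta k) ^ P.d := pow_pos hη _
  have hs0 : 0 < s := Real.sqrt_pos.2 hw
  have hs1 : s ≠ 0 := hs0.ne'
  have hηT : P.eta k * (P.L : ℝ) ^ k = 1 := eta_mul_L_pow P k
  have hσ0 : σ ≠ 0 := by
    rw [hσ]; split_ifs
    · exact inv_ne_zero hη.ne'
    · exact neg_ne_zero.2 (inv_ne_zero hη.ne')
  have habsσ : |σ⁻¹| = P.eta k := by rw [hσ]; split_ifs <;> simp [abs_of_pos hη]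
  have hx : Site.scaleTo k y' = z.shift ν := by rw [hz, Site.shift_unshift]
  -- Stokes on the strip
  have hstokes := sum_runBond_shift_eq A z hμν T
  rw [← hx] at hstokes
  have hdiff : ∑ t ∈ range T, A (runBond (Site.scaleTo k y') μ t) - ∑ t ∈ range T, A (runBond z μ t) =
      (A ⟨runSite z μ T, ν⟩ - A ⟨z, ν⟩) - ∑ t ∈ range T, circ A (runSite z μ t) μ ν := by
    rw [hstokes]; ring
  rw [hdiff]
  -- the circulations through `Q^{e*}_kg` and the residual field
  have hcirc : ∀ t, circ A (runSite z μ t) μ ν = σ⁻¹ * (QestarIter hd k g (plaqOf (runSite z μ t) hμν) -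
      s⁻¹ * resE hd ((P.eta k) ^ P.d) (P.eta k)⁻¹ k (toU P k g) (plaqOf (runSite z μ t) hμν)) := by
    intro t
    have h2 : σ * circ A (runSite z μ t) μ ν = QestarIter hd k g (plaqOf (runSite z μ t) hμν) -
        s⁻¹ * resE hd ((P.eta k) ^ P.d) (P.eta k)⁻¹ k (toU P k g) (plaqOf (runSite z μ t) hμν) := by
      rw [hσ, ← curl_plaqOf (P.eta k)⁻¹ A (runSite z μ t) hμν, hA]
      exact curl_TkF_eq hd hk g _
    rw [← h2, ← mul_assoc, inv_mul_cancel₀ hσ0, one_mul]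
  have hres : ∀ t, |resE hd ((P.eta k) ^ P.d) (P.eta k)⁻¹ k (toU P k g) (plaqOf (runSite z μ t) hμν)| ≤ KR * s * C :=
    fun t => hR _
  have hQ := abs_sum_QestarIter_strip_le hd hk y' hμν g hC hg
  have hsum_circ : |∑ t ∈ range T, circ A (runSite z μ t) μ ν| ≤
      P.eta k * (((P.L : ℝ) ^ k) ^ 2 * C + T * (s⁻¹ * (KR * s * C))) := by
    simp_rw [hcirc]
    rw [← Finset.mul_sum, abs_mul, habsσ, Finset.sum_sub_distrib]
    refine mul_le_mul_of_nonneg_left ((abs_sub _ _).trans (add_le_add hQ ?_)) hη.le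
    rw [← Finset.mul_sum, abs_mul, abs_of_pos (inv_pos.2 hs0)]
    calc s⁻¹ * |∑ t ∈ range T, resE hd ((P.eta k) ^ P.d) (P.eta k)⁻¹ k (toU P k g) (plaqOf (runSite z μ t) hμν)|
        ≤ s⁻¹ * ∑ t ∈ range T, KR * s * C :=
          mul_le_mul_of_nonneg_left ((Finset.abs_sum_le_sum_abs _ _).trans (Finset.sum_le_sum fun t _ => hres t))
            (inv_pos.2 hs0).le
      _ = T * (s⁻¹ * (KR * s * C)) := by rw [Finset.sum_const, Finset.card_range, nsmul_eq_mul]; ring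
  have e1 : s⁻¹ * (KR * s * C) = KR * C := by
    calc s⁻¹ * (KR * s * C) = (s⁻¹ * s) * (KR * C) := by ring
      _ = KR * C := by rw [inv_mul_cancel₀ hs1, one_mul]
  have hT_real : ((T : ℕ) : ℝ) = (P.L : ℝ) ^ k := by rw [hT, Nat.cast_pow]
  have hcirc' : P.eta k * |∑ t ∈ range T, circ A (runSite z μ t) μ ν| ≤ C + P.eta k * (KR * C) := by
    calc P.eta k * |∑ t ∈ range T, circ A (runSite z μ t) μ ν|
        ≤ P.eta k * (P.eta k * (((P.L : ℝ) ^ k) ^ 2 * C + T * (s⁻¹ * (KR * s * C)))) :=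
          mul_le_mul_of_nonneg_left hsum_circ hη.le
      _ = (P.eta k * (P.L : ℝ) ^ k) ^ 2 * C + (P.eta k * (P.L : ℝ) ^ k) * (P.eta k * (KR * C)) := by
          rw [e1, hT_real]; ring
      _ = C + P.eta k * (KR * C) := by rw [hηT]; ring
  -- the two ν-bonds and the assembly
  have hb1 := hinf ⟨runSite z μ T, ν⟩
  have hb2 := hinf ⟨z, ν⟩
  have hKRC : 0 ≤ KR * C := by
    have h := (abs_nonneg _).trans (hR (plaqOf z hμν))
    exact le_of_mul_le_mul_right (by rw [zero_mul]; linarith [h, show KR * s * C = KR * C * s by ring]) hs0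
  calc P.eta k * |A ⟨runSite z μ T, ν⟩ - A ⟨z, ν⟩ - ∑ t ∈ range T, circ A (runSite z μ t) μ ν|
      ≤ P.eta k * (|A ⟨runSite z μ T, ν⟩| + |A ⟨z, ν⟩| + |∑ t ∈ range T, circ A (runSite z μ t) μ ν|) :=
        mul_le_mul_of_nonneg_left ((abs_sub _ _).trans (add_le_add (abs_sub _ _) le_rfl)) hη.le
    _ = P.eta k * |A ⟨runSite z μ T, ν⟩| + P.eta k * |A ⟨z, ν⟩| +
          P.eta k * |∑ t ∈ range T, circ A (runSite z μ t) μ ν| := by ring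
    _ ≤ Kinf * C + Kinf * C + (C + P.eta k * (KR * C)) := add_le_add (add_le_add hb1 hb2) hcirc'
    _ ≤ Kinf * C + Kinf * C + (C + 1 * (KR * C)) := by
        have := mul_le_mul_of_nonneg_right hη1 hKRC
        linarith
    _ = (2 * Kinf + 1 + KR) * C := by ring

/-! ## §5  The pointwise bound `η|T_kg(b)| ≤ K_∞·max|g|` (`d = 2`) -/

/-- kernel: a sum over the unit plaquettes of a nonnegative function of the base point is at most `d²` times the sum over the
sites (p09's private `sum_plaq_src_le`). [folklore] -/
private theorem sum_plaq_src_le' {k : ℕ} (f : TSite P k → ℝ) (hf : ∀ y, 0 ≤ f y) :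
    ∑ p : TPlaq P k, f p.src ≤ (P.d : ℝ) ^ 2 * ∑ y : TSite P k, f y := by
  classical
  rw [← Finset.sum_fiberwise_of_maps_to (s := (Finset.univ : Finset (TPlaq P k))) (t := (Finset.univ : Finset (TSite P k)))
    (g := fun p : TPlaq P k => p.src) (fun _ _ => Finset.mem_univ _), Finset.mul_sum]
  refine Finset.sum_le_sum fun y _ => ?_
  have hfib : ∑ p ∈ Finset.univ.filter (fun p : TPlaq P k => p.src = y), f p.src =
      ((Finset.univ.filter (fun p : TPlaq P k => p.src = y)).card : ℝ) * f y := by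
    rw [Finset.sum_congr rfl (fun p hp => by rw [(Finset.mem_filter.1 hp).2]), Finset.sum_const, nsmul_eq_mul]
  rw [hfib]
  refine mul_le_mul_of_nonneg_right ?_ (hf y)
  have hcard : (Finset.univ.filter (fun p : TPlaq P k => p.src = y)).card ≤
      (Finset.univ ×ˢ Finset.univ : Finset (Fin P.d × Fin P.d)).card := by
    refine Finset.card_le_card_of_injOn (fun p => (p.μ, p.ν)) (fun _ _ => Finset.mem_coe.2 (Finset.mem_univ _)) ?_
    intro p hp p' hp' h
    have h1 := (Finset.mem_filter.1 (Finset.mem_coe.1 hp)).2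
    have h2 := (Finset.mem_filter.1 (Finset.mem_coe.1 hp')).2
    obtain ⟨s, μ, ν, hμν⟩ := p
    obtain ⟨s', μ', ν', hμν'⟩ := p'
    simp only [Prod.mk.injEq] at h
    simp only at h1 h2
    subst h1; subst h2
    obtain ⟨rfl, rfl⟩ := h
    rfl
  rw [Finset.card_product, Finset.card_univ, Fintype.card_fin] at hcard
  have : ((Finset.univ.filter (fun p : TPlaq P k => p.src = y)).card : ℝ) ≤ ((P.d * P.d : ℕ) : ℝ) := by exact_mod_cast hcard
  simpa [sq] using this

/-- kernel: there is a unit plaquette (`d ≥ 2`), so a uniform bound `|g| ≤ C` forces `0 ≤ C`. [folklore] -/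
private theorem nonneg_of_bound' (hd : 2 ≤ P.d) {k : ℕ} {g : TPlaq P k → ℝ} {C : ℝ} (hg : ∀ q, |g q| ≤ C) : 0 ≤ C :=
  (abs_nonneg _).trans (hg ⟨default, ⟨0, by omega⟩, ⟨1, by omega⟩, by simp [Fin.lt_def]⟩)

/-- kernel: a finite geometric sum with ratio `0 ≤ r < 1` is at most `(1 − r)⁻¹`. [folklore] -/
private theorem geom_sum_le_inv {r : ℝ} (hr0 : 0 ≤ r) (hr1 : r < 1) (k : ℕ) : ∑ j ∈ range k, r ^ j ≤ (1 - r)⁻¹ := by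
  have h1 : 0 < 1 - r := by linarith
  rw [inv_eq_one_div, le_div_iff₀ h1, geom_sum_mul_neg]
  have := pow_nonneg hr0 k
  linarith

/-- kernel: **an edge plaquette of `B^e_k(p)` is within half a block of `p`** in the scale-`j` distance: for `q ∈ B^e_k(p)`, `j ≤ k` and
`a ≥ 0`, `e^{−a|x − q₋|_∞/L^j} ≤ e^{a/2}·e^{−a|x − p|}` (`|x − p| = distEU P k x p₋`; p08's `supDist_ctr_le_of_mem`).
[cite: BalabanImbrieJaffe1985, (7.2.2) p.325] -/
theorem exp_le_of_mem_edgeB (hd : 2 ≤ P.d) {k j : ℕ} (hk : k ≤ P.m + P.K) (hjk : j ≤ k) {a : ℝ} (ha : 0 ≤ a) (x : TSite P 0)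
    {p : TPlaq P k} {q : TPlaq P 0} (hq : q ∈ (torusEdgeCellsTo P 0 k k (Nat.zero_add k) hd).B p) :
    Real.exp (-(a * ((supDist x q.src : ℝ) / (P.L : ℝ) ^ j))) ≤ Real.exp (a / 2) * Real.exp (-(a * distEU P k x p.src)) := by
  have hLj : 0 < (P.L : ℝ) ^ j := cast_pow_L_pos' j
  have hLk : 0 < (P.L : ℝ) ^ k := cast_pow_L_pos' k
  have hLjk : (P.L : ℝ) ^ j ≤ (P.L : ℝ) ^ k := pow_le_pow_right₀ (by exact_mod_cast P.L_pos) hjk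
  rw [← Real.exp_add]
  apply Real.exp_le_exp.2
  have h1 : (supDist q.src (ctr k p.src) : ℝ) ≤ ((P.L : ℝ) ^ k - 1) / 2 := by
    have h := supDist_ctr_le_of_mem hd hk hq
    have h' : ((supDist q.src (ctr k p.src) : ℕ) : ℝ) ≤ (((P.L ^ k - 1) / 2 : ℕ) : ℝ) := by exact_mod_cast h
    refine h'.trans ?_
    have hL1 : (1 : ℕ) ≤ P.L ^ k := Nat.one_le_pow _ _ P.L_pos
    have h2 : (((P.L ^ k - 1) / 2 : ℕ) : ℝ) ≤ (((P.L ^ k - 1 : ℕ)) : ℝ) / 2 := Nat.cast_div_le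
    rw [Nat.cast_sub hL1] at h2
    push_cast at h2
    exact h2
  have h2 : (supDist x (ctr k p.src) : ℝ) ≤ (supDist x q.src : ℝ) + (supDist q.src (ctr k p.src) : ℝ) := by
    exact_mod_cast supDist_triangle x q.src (ctr k p.src)
  have h3 : distEU P k x p.src = (supDist x (ctr k p.src) : ℝ) / (P.L : ℝ) ^ k := rfl
  have hd0 : 0 ≤ (supDist x q.src : ℝ) := Nat.cast_nonneg _
  -- `|x − p| ≤ |x − q|/L^j + 1/2`
  have h4 : distEU P k x p.src ≤ (supDist x q.src : ℝ) / (P.L : ℝ) ^ j + 1 / 2 := by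
    rw [h3, div_le_iff₀ hLk]
    have h5 : (supDist x q.src : ℝ) / (P.L : ℝ) ^ j * (P.L : ℝ) ^ k ≥ (supDist x q.src : ℝ) := by
      rw [ge_iff_le, ← div_le_iff₀ hLk]
      exact div_le_div_of_nonneg_left hd0 hLj hLjk
    nlinarith
  nlinarith

/-- **THE POINTWISE BOUND ON THE CORRECTION, `d = 2`**: `η·|(T_kg)(b)| ≤ K_∞·max|g|` at every η-bond `b`, with
`K_∞ = 4M²M_Cd²K(a)²·e^{a/2}d²S(a)` (`a = min(δ,δ_C)/2`, `K(a) = e^{a/2}(2(1+d/a))^d = S(a)`) INDEPENDENT OF `k` — from p09's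
scale-`j` majorant `abs_term_le` (size `η·(L^k/L^j) = L^{−j}`, summable geometrically in the scale) given the two members of (7.2.2)
for every `H_j`, `j < k`, and (7.2.3) for every `C^{(j)}` (`k ≤ m + K`). [cite: BalabanImbrieJaffe1985, (7.2.2)–(7.2.3) p.325] -/
theorem eta_abs_TkF_le_two (hd : 2 ≤ P.d) (hd2 : P.d = 2) {k : ℕ} (hk : k ≤ P.m + P.K) {a : ℝ} (ha : 0 < a)
    {δ M δC MC : ℝ} (hδ : 0 < δ) (hδC : 0 < δC) (hMC : 0 ≤ MC)
    (hH : ∀ (j : ℕ) (hj : j ≤ P.m + P.K), j < k → ∀ (μ ν : Fin P.d) (x : TSite P 0) (y : TSite P j),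
      |(torusRep P j (deltaAData hj a)).H (x, μ) (y, ν)| ≤ M * Real.exp (-(δ * distEU P j x y)))
    (hB : ∀ (j : ℕ) (hj : j ≤ P.m + P.K), j < k → ∀ (μ ν : Fin P.d) (x : TSite P 0) (y : TSite P j),
      ‖fun lam : Fin P.d => (P.L : ℝ) ^ j *
          ((torusRep P j (deltaAData hj a)).H (x.shift lam, μ) (y, ν) - (torusRep P j (deltaAData hj a)).H (x, μ) (y, ν))‖ ≤
        M * Real.exp (-(δ * distEU P j x y)))
    (hC : ∀ j < k, ∀ b₁ b₂ : PBond P j, |⟪toEj P j (Pi.single b₁ 1),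
      CE P ((P.eta j) ^ P.d) ((P.L : ℝ) ^ j) j (toEj P j (Pi.single b₂ 1))⟫| ≤ MC * Real.exp (-(δC * (supDist b₁.src b₂.src : ℝ))))
    (g : TPlaq P k → ℝ) {C : ℝ} (hg : ∀ q, |g q| ≤ C) (b : PBond P 0) :
    P.eta k * |TkF P hd ((P.eta k) ^ P.d) (P.eta k) k g b| ≤
      (2 * (2 * M ^ 2 * MC * (P.d : ℝ) ^ 2 * (Real.exp (min δ δC / 2 / 2) * ((2 * (1 + P.d / (min δ δC / 2))) ^ P.d) ^ 2) *
        (Real.exp (min δ δC / 2 / 2) * ((P.d : ℝ) ^ 2 *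
          (Real.exp ((min δ δC / 2) / 2) * (2 * (1 + P.d / (min δ δC / 2))) ^ P.d))))) * C := by
  set a₀ : ℝ := min δ δC / 2 with ha₀
  have ha₀p : 0 < a₀ := by rw [ha₀]; exact half_pos (lt_min hδ hδC)
  have hC0 : 0 ≤ C := nonneg_of_bound' hd hg
  have hLk : 0 < (P.L : ℝ) ^ k := cast_pow_L_pos' k
  have hηk : P.eta k = ((P.L : ℝ) ^ k)⁻¹ := by rw [← eta_inv P k, inv_inv]
  set K1 : ℝ := Real.exp (a₀ / 2) * ((2 * (1 + P.d / a₀)) ^ P.d) ^ 2 with hK1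
  set S' : ℝ := Real.exp (a₀ / 2) * ((P.d : ℝ) ^ 2 * (Real.exp (a₀ / 2) * (2 * (1 + P.d / a₀)) ^ P.d)) with hS'
  set K₀ : ℝ := 2 * M ^ 2 * MC * (P.d : ℝ) ^ 2 * K1 * S' with hK₀
  -- the case k = 0: no scale, the correction vanishes
  rcases Nat.eq_zero_or_pos k with hk0 | hkpos
  · subst hk0
    rw [TkF_eq_triple_sum]
    simp only [Finset.range_zero, Finset.sum_empty, mul_zero, Finset.sum_const_zero, abs_zero]
    positivity
  have hK1p : 0 < K1 := by rw [hK1]; positivity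
  have hS'p : 0 < S' := by rw [hS']; positivity
  have hK₀nn : 0 ≤ K₀ := by rw [hK₀]; positivity
  set G := torusEdgeCellsTo P 0 k k (Nat.zero_add k) hd with hG
  -- the scale-j term at the bond `b` against the plaquette `p`
  let T : TPlaq P k → ℕ → ℝ := fun p j => ∑ b₁ : PBond P j, ∑ b₂ : PBond P j,
    HkE P ((P.eta k) ^ P.d) ((P.L : ℝ) ^ k) j (toEj P j (Pi.single b₁ 1)) b *
      ⟪toEj P j (Pi.single b₁ 1), CE P ((P.eta k) ^ P.d) ((P.L : ℝ) ^ k) j (toEj P j (Pi.single b₂ 1))⟫ *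
      LinearMap.adjoint (HkE P ((P.eta k) ^ P.d) ((P.L : ℝ) ^ k) j)
        (LinearMap.adjoint (curlOp (P := P) ((P.eta k) ^ P.d) ((P.L : ℝ) ^ k))
          (QesOp (P := P) hd ((P.eta k) ^ P.d) k (toU P k (Pi.single p 1)))) b₂
  have hrepr : TkF P hd ((P.eta k) ^ P.d) (P.eta k) k g b = ∑ p : TPlaq P k, g p * ∑ j ∈ Finset.range k, T p j := by
    rw [TkF_eq_triple_sum hd]
    simp_rw [eta_inv P k]
    rfl
  -- per (p, j): §2 of p09 with every face plaquette within half a block of `p`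
  have hterm : ∀ (p : TPlaq P k) (j : ℕ), j < k →
      |T p j| ≤ (2 * M ^ 2 * (MC * ((P.L : ℝ) ^ (k - j)) ^ (P.d - 2)) * (P.d : ℝ) ^ 2 * K1 * ((P.L : ℝ) ^ k / (P.L : ℝ) ^ j)) *
        (Real.exp (a₀ / 2) * Real.exp (-(a₀ * distEU P k b.src p.src))) := by
    intro p j hjk
    have h := abs_term_le hd hk hjk ha hδ hδC (hH j (by omega) hjk) (hB j (by omega) hjk) (hC j hjk) b p
    refine h.trans ?_
    rw [← ha₀, ← hK1]
    set κ : ℝ := (((P.L : ℝ) ^ k) ^ (P.d - 2))⁻¹ with hκ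
    set A : ℝ := 2 * M ^ 2 * (MC * ((P.L : ℝ) ^ (k - j)) ^ (P.d - 2)) * (P.d : ℝ) ^ 2 * K1 * ((P.L : ℝ) ^ k / (P.L : ℝ) ^ j) with hA
    have hκ0 : 0 ≤ κ := by rw [hκ]; positivity
    have hA0 : 0 ≤ A := by rw [hA]; positivity
    have hq : ∀ q ∈ G.B p, Real.exp (-(a₀ * ((supDist b.src q.src : ℝ) / (P.L : ℝ) ^ j))) ≤
        Real.exp (a₀ / 2) * Real.exp (-(a₀ * distEU P k b.src p.src)) :=
      fun q hq => exp_le_of_mem_edgeB hd hk hjk.le ha₀p.le b.src hq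
    have hcardN : (G.B p).card = (P.L ^ k) ^ (P.d - 2) := BIJ85Eq224Base0.card_edgeBTo (Nat.zero_add k) hk hd p
    have hcard : ((G.B p).card : ℝ) = ((P.L : ℝ) ^ k) ^ (P.d - 2) := by rw [hcardN]; push_cast; ring
    calc A * κ * ∑ q ∈ G.B p, Real.exp (-(a₀ * ((supDist b.src q.src : ℝ) / (P.L : ℝ) ^ j)))
        ≤ A * κ * ∑ q ∈ G.B p, Real.exp (a₀ / 2) * Real.exp (-(a₀ * distEU P k b.src p.src)) :=
          mul_le_mul_of_nonneg_left (Finset.sum_le_sum hq) (mul_nonneg hA0 hκ0)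
      _ = A * (κ * (G.B p).card) * (Real.exp (a₀ / 2) * Real.exp (-(a₀ * distEU P k b.src p.src))) := by
          rw [Finset.sum_const, nsmul_eq_mul]; ring
      _ = A * (Real.exp (a₀ / 2) * Real.exp (-(a₀ * distEU P k b.src p.src))) := by
          rw [hcard, hκ, inv_mul_cancel₀ (pow_pos hLk _).ne', mul_one]
  -- per scale, summed over the unit plaquettes with the weights |g p|, after the factor η (here d = 2)
  have hscale : ∀ j ∈ Finset.range k, P.eta k * ∑ p : TPlaq P k, |g p| * |T p j| ≤ C * K₀ * ((P.L : ℝ)⁻¹) ^ j := by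
    intro j hj
    have hjk : j < k := Finset.mem_range.1 hj
    have hLj : 0 < (P.L : ℝ) ^ j := cast_pow_L_pos' j
    have hd0 : P.d - 2 = 0 := by omega
    set Aj : ℝ := 2 * M ^ 2 * (MC * ((P.L : ℝ) ^ (k - j)) ^ (P.d - 2)) * (P.d : ℝ) ^ 2 * K1 * ((P.L : ℝ) ^ k / (P.L : ℝ) ^ j)
      with hAj
    have hAj0 : 0 ≤ Aj := by rw [hAj]; positivity
    have hS := sum_exp_neg_distEU_le hk ha₀p b.src
    have h1 : ∑ p : TPlaq P k, |g p| * |T p j| ≤ C * (Aj * Real.exp (a₀ / 2)) * ∑ p : TPlaq P k, Real.exp (-(a₀ * distEU P k b.src p.src)) := by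
      rw [Finset.mul_sum]
      refine Finset.sum_le_sum fun p _ => ?_
      calc |g p| * |T p j| ≤ C * (Aj * (Real.exp (a₀ / 2) * Real.exp (-(a₀ * distEU P k b.src p.src)))) :=
            mul_le_mul (hg p) (hterm p j hjk) (abs_nonneg _) hC0
        _ = _ := by ring
    have h2 : ∑ p : TPlaq P k, Real.exp (-(a₀ * distEU P k b.src p.src)) ≤
        (P.d : ℝ) ^ 2 * (Real.exp (a₀ / 2) * (2 * (1 + P.d / a₀)) ^ P.d) :=
      (sum_plaq_src_le' (fun y => Real.exp (-(a₀ * distEU P k b.src y))) fun _ => (Real.exp_pos _).le).trans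
        (mul_le_mul_of_nonneg_left hS (by positivity))
    have h3 : ∑ p : TPlaq P k, |g p| * |T p j| ≤ C * (Aj * S') :=
      h1.trans (by rw [hS']; nlinarith [mul_le_mul_of_nonneg_left h2 (show 0 ≤ C * (Aj * Real.exp (a₀ / 2)) by positivity)])
    have h4 : P.eta k * Aj = 2 * M ^ 2 * MC * (P.d : ℝ) ^ 2 * K1 * ((P.L : ℝ)⁻¹) ^ j := by
      rw [hAj, hd0, pow_zero, mul_one, hηk, inv_pow]
      field_simp
    calc P.eta k * ∑ p : TPlaq P k, |g p| * |T p j| ≤ P.eta k * (C * (Aj * S')) :=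
          mul_le_mul_of_nonneg_left h3 (eta_pos P k).le
      _ = C * ((P.eta k * Aj) * S') := by ring
      _ = C * K₀ * ((P.L : ℝ)⁻¹) ^ j := by rw [h4, hK₀]; ring
  -- the geometric sum over the scales
  have hL2 : (2 : ℝ) ≤ P.L := by exact_mod_cast P.hL.2
  have hr0 : 0 ≤ (P.L : ℝ)⁻¹ := inv_nonneg.2 P.cast_L_pos.le
  have hr1 : (P.L : ℝ)⁻¹ < 1 := inv_lt_one_of_one_lt₀ (by linarith)
  have hgeom : ∑ j ∈ Finset.range k, ((P.L : ℝ)⁻¹) ^ j ≤ 2 := by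
    refine (geom_sum_le_inv hr0 hr1 k).trans ?_
    have : (P.L : ℝ)⁻¹ ≤ 1 / 2 := by rw [inv_eq_one_div]; exact one_div_le_one_div_of_le two_pos hL2
    rw [inv_le_comm₀ (by linarith) two_pos]
    linarith
  -- assemble
  rw [hrepr]
  calc P.eta k * |∑ p : TPlaq P k, g p * ∑ j ∈ Finset.range k, T p j|
      ≤ P.eta k * ∑ p : TPlaq P k, ∑ j ∈ Finset.range k, |g p| * |T p j| := by
        refine mul_le_mul_of_nonneg_left ((Finset.abs_sum_le_sum_abs _ _).trans (Finset.sum_le_sum fun p _ => ?_)) (eta_pos P k).le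
        rw [abs_mul, ← Finset.mul_sum]
        exact mul_le_mul_of_nonneg_left (Finset.abs_sum_le_sum_abs _ _) (abs_nonneg _)
    _ = ∑ j ∈ Finset.range k, P.eta k * ∑ p : TPlaq P k, |g p| * |T p j| := by rw [Finset.sum_comm, Finset.mul_sum]
    _ ≤ ∑ j ∈ Finset.range k, C * K₀ * ((P.L : ℝ)⁻¹) ^ j := Finset.sum_le_sum hscale
    _ = C * K₀ * ∑ j ∈ Finset.range k, ((P.L : ℝ)⁻¹) ^ j := by rw [Finset.mul_sum]
    _ ≤ C * K₀ * 2 := mul_le_mul_of_nonneg_left hgeom (by positivity)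
    _ = 2 * K₀ * C := by ring
    _ = _ := by rw [hK₀, hK1, hS', ha₀]

/-! ## §6  The line sum over FAR sources, uniformly in `k` (`d = 2`) -/

/-- kernel: splitting the rate of a far term, one third for the distance gain, two thirds for p09's line count and worst bond.
[folklore] -/
private theorem exp_split_far {a x D : ℝ} (ha : 0 ≤ a) (hD : D ≤ x) :
    Real.exp (-(a * x)) ≤ Real.exp (-(a / 3 * D)) * Real.exp (-(2 * a / 3 * x)) := by
  rw [← Real.exp_add]
  apply Real.exp_le_exp.2
  nlinarith

/-- kernel: `n + 1 ≤ L^n` for `L ≥ 2`. [folklore] -/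
private theorem succ_le_pow {L : ℕ} (hL : 2 ≤ L) : ∀ n : ℕ, n + 1 ≤ L ^ n
  | 0 => by simp
  | n + 1 => by
    have ih := succ_le_pow hL n
    calc n + 1 + 1 ≤ 2 * (n + 1) := by omega
      _ ≤ 2 * L ^ n := Nat.mul_le_mul_left 2 ih
      _ ≤ L * L ^ n := Nat.mul_le_mul_right _ hL
      _ = L ^ (n + 1) := (pow_succ' L n).symm

/-- kernel: **the far factor is geometric in the scale**: `e^{−(a/3)(L^k − 1)/L^j} ≤ (e^{−a/3})^{k−j}` (`(L^k−1)/L^j ≥ k − j`).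
[cite: BalabanImbrieJaffe1985, (7.2.2) p.325] -/
private theorem exp_far_le {k j : ℕ} (hjk : j < k) {a : ℝ} (ha : 0 ≤ a) :
    Real.exp (-(a / 3 * ((((P.L : ℝ) ^ k) - 1) / (P.L : ℝ) ^ j))) ≤ Real.exp (-(a / 3)) ^ (k - j) := by
  rw [← Real.exp_nat_mul]
  apply Real.exp_le_exp.2
  have hLj : 0 < (P.L : ℝ) ^ j := cast_pow_L_pos' j
  have hLj1 : 1 ≤ (P.L : ℝ) ^ j := one_le_pow₀ (by exact_mod_cast P.L_pos)
  have h1 : ((k - j : ℕ) : ℝ) + 1 ≤ (P.L : ℝ) ^ (k - j) := by exact_mod_cast succ_le_pow P.hL.2 (k - j)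
  have h2 : (P.L : ℝ) ^ k = (P.L : ℝ) ^ (k - j) * (P.L : ℝ) ^ j := by rw [← pow_add, Nat.sub_add_cancel hjk.le]
  have h3 : ((k - j : ℕ) : ℝ) ≤ ((P.L : ℝ) ^ k - 1) / (P.L : ℝ) ^ j := by
    rw [le_div_iff₀ hLj, h2]
    have h0 : 0 ≤ ((k - j : ℕ) : ℝ) := Nat.cast_nonneg _
    nlinarith
  nlinarith

/-- **THE LINE SUM OVER FAR SOURCES IS BOUNDED UNIFORMLY IN `k` (`d = 2`)**: if every unit plaquette `p` charged by `g` has all its edge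
plaquettes at sup-distance `≥ L^k − 1` from every bond of the line `{⟨x₀ + te_μ, μ⟩ : t < L^k}`, then
`η·|Σ_{t<L^k}(T_kg)(x₀ + te_μ)| ≤ K_far·max|g|` with `K_far` depending only on `M, M_C, δ, δ_C` — p09's scale-`j` line bound with the
rate split `a = a/3 + 2a/3`: the third spent on the distance `≥ L^k − 1` gives the factor `e^{−(a/3)(L^k−1)/L^j} ≤ (e^{−a/3})^{k−j}`,
summable over the scales (`k ≤ m + K`, given (7.2.2) for `H_j`, (7.2.3) for `C^{(j)}`, `j < k`). [cite: BalabanImbrieJaffe1985, (7.2.2)–(7.2.3) p.325] -/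
theorem eta_abs_sum_TkF_far_le_two (hd : 2 ≤ P.d) (hd2 : P.d = 2) {k : ℕ} (hk : k ≤ P.m + P.K) {a : ℝ} (ha : 0 < a)
    {δ M δC MC : ℝ} (hδ : 0 < δ) (hδC : 0 < δC) (hMC : 0 ≤ MC)
    (hH : ∀ (j : ℕ) (hj : j ≤ P.m + P.K), j < k → ∀ (μ ν : Fin P.d) (x : TSite P 0) (y : TSite P j),
      |(torusRep P j (deltaAData hj a)).H (x, μ) (y, ν)| ≤ M * Real.exp (-(δ * distEU P j x y)))
    (hB : ∀ (j : ℕ) (hj : j ≤ P.m + P.K), j < k → ∀ (μ ν : Fin P.d) (x : TSite P 0) (y : TSite P j),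
      ‖fun lam : Fin P.d => (P.L : ℝ) ^ j *
          ((torusRep P j (deltaAData hj a)).H (x.shift lam, μ) (y, ν) - (torusRep P j (deltaAData hj a)).H (x, μ) (y, ν))‖ ≤
        M * Real.exp (-(δ * distEU P j x y)))
    (hC : ∀ j < k, ∀ b₁ b₂ : PBond P j, |⟪toEj P j (Pi.single b₁ 1),
      CE P ((P.eta j) ^ P.d) ((P.L : ℝ) ^ j) j (toEj P j (Pi.single b₂ 1))⟫| ≤ MC * Real.exp (-(δC * (supDist b₁.src b₂.src : ℝ))))
    (x₀ : TSite P 0) (μ : Fin P.d) (g : TPlaq P k → ℝ) {C : ℝ} (hg : ∀ q, |g q| ≤ C)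
    (hfar : ∀ p : TPlaq P k, g p ≠ 0 → ∀ q ∈ (torusEdgeCellsTo P 0 k k (Nat.zero_add k) hd).B p, ∀ t ∈ range (P.L ^ k),
      (P.L : ℝ) ^ k - 1 ≤ (supDist (runSite x₀ μ t) q.src : ℝ)) :
    P.eta k * |∑ t ∈ range (P.L ^ k), TkF P hd ((P.eta k) ^ P.d) (P.eta k) k g (runBond x₀ μ t)| ≤
      (2 * M ^ 2 * MC * (P.d : ℝ) ^ 2 * (Real.exp (min δ δC / 2 / 2) * ((2 * (1 + P.d / (min δ δC / 2))) ^ P.d) ^ 2) *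
        (2 * (1 + 2 / (2 * (min δ δC / 2) / 3)) * Real.exp (3 * (2 * (min δ δC / 2) / 3) / 4) *
          ((P.d : ℝ) ^ 2 * (Real.exp ((2 * (min δ δC / 2) / 3) / 2 / 2) *
            (2 * (1 + P.d / ((2 * (min δ δC / 2) / 3) / 2))) ^ P.d))) *
        (1 - Real.exp (-(min δ δC / 2 / 3)))⁻¹) * C := by
  set a₀ : ℝ := min δ δC / 2 with ha₀
  have ha₀p : 0 < a₀ := by rw [ha₀]; exact half_pos (lt_min hδ hδC)
  set a₁ : ℝ := 2 * a₀ / 3 with ha₁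
  have ha₁p : 0 < a₁ := by rw [ha₁]; positivity
  have hC0 : 0 ≤ C := nonneg_of_bound' hd hg
  have hLk : 0 < (P.L : ℝ) ^ k := cast_pow_L_pos' k
  have hηk : P.eta k = ((P.L : ℝ) ^ k)⁻¹ := by rw [← eta_inv P k, inv_inv]
  set K1 : ℝ := Real.exp (a₀ / 2) * ((2 * (1 + P.d / a₀)) ^ P.d) ^ 2 with hK1
  set S'' : ℝ := (P.d : ℝ) ^ 2 * (Real.exp (a₁ / 2 / 2) * (2 * (1 + P.d / (a₁ / 2))) ^ P.d) with hS''
  set W' : ℝ := 2 * (1 + 2 / a₁) with hW'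
  set Kf : ℝ := 2 * M ^ 2 * MC * (P.d : ℝ) ^ 2 * K1 * (W' * Real.exp (3 * a₁ / 4) * S'') with hKf
  set r : ℝ := Real.exp (-(a₀ / 3)) with hr
  have hr0 : 0 ≤ r := (Real.exp_pos _).le
  have hr1 : r < 1 := by rw [hr]; exact Real.exp_lt_one_iff.2 (by linarith)
  have hr1' : r ≤ 1 := hr1.le
  have hKf0 : 0 ≤ Kf := by rw [hKf]; positivity
  -- the case k = 0
  rcases Nat.eq_zero_or_pos k with hk0 | hkpos
  · subst hk0
    simp only [pow_zero, Finset.range_one, Finset.sum_singleton]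
    rw [TkF_eq_triple_sum]
    simp only [Finset.range_zero, Finset.sum_empty, mul_zero, Finset.sum_const_zero, abs_zero, mul_zero]
    have : 0 < 1 - r := by linarith
    positivity
  have hsites : P.L ^ k ≤ P.sitesPerDir 0 := by
    rw [sitesPerDir_zero_eq hk]
    exact Nat.le_mul_of_pos_left _ (by have := two_le_sitesPerDir (P := P) k; omega)
  -- the scale-j term at the bond `x₀ + te_μ` against the plaquette `p`
  let T : ℕ → TPlaq P k → ℕ → ℝ := fun t p j => ∑ b₁ : PBond P j, ∑ b₂ : PBond P j,
    HkE P ((P.eta k) ^ P.d) ((P.L : ℝ) ^ k) j (toEj P j (Pi.single b₁ 1)) (runBond x₀ μ t) *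
      ⟪toEj P j (Pi.single b₁ 1), CE P ((P.eta k) ^ P.d) ((P.L : ℝ) ^ k) j (toEj P j (Pi.single b₂ 1))⟫ *
      LinearMap.adjoint (HkE P ((P.eta k) ^ P.d) ((P.L : ℝ) ^ k) j)
        (LinearMap.adjoint (curlOp (P := P) ((P.eta k) ^ P.d) ((P.L : ℝ) ^ k))
          (QesOp (P := P) hd ((P.eta k) ^ P.d) k (toU P k (Pi.single p 1)))) b₂
  have hrepr : ∑ t ∈ range (P.L ^ k), TkF P hd ((P.eta k) ^ P.d) (P.eta k) k g (runBond x₀ μ t) =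
      ∑ t ∈ range (P.L ^ k), ∑ p : TPlaq P k, g p * ∑ j ∈ Finset.range k, T t p j := by
    refine Finset.sum_congr rfl fun t _ => ?_
    rw [TkF_eq_triple_sum hd]
    simp_rw [eta_inv P k]
    rfl
  -- per (t, p, j): p09's §2
  have hterm : ∀ (t : ℕ) (p : TPlaq P k) (j : ℕ), j < k →
      |T t p j| ≤ (2 * M ^ 2 * (MC * ((P.L : ℝ) ^ (k - j)) ^ (P.d - 2)) * (P.d : ℝ) ^ 2 * K1 * ((P.L : ℝ) ^ k / (P.L : ℝ) ^ j)) *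
        (((P.L : ℝ) ^ k) ^ (P.d - 2))⁻¹ *
          ∑ q ∈ (torusEdgeCellsTo P 0 k k (Nat.zero_add k) hd).B p, Real.exp (-(a₀ * ((supDist (runSite x₀ μ t) q.src : ℝ) / (P.L : ℝ) ^ j))) := by
    intro t p j hjk
    have h := abs_term_le hd hk hjk ha hδ hδC (hH j (by omega) hjk) (hB j (by omega) hjk) (hC j hjk) (runBond x₀ μ t) p
    have hsrc : (runBond x₀ μ t).src = runSite x₀ μ t := rfl
    rw [hsrc] at h
    refine h.trans (le_of_eq ?_)
    rw [← ha₀, ← hK1]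
  -- per (p, j): the line sum of the scale-j term against a FAR plaquette
  have hline : ∀ (p : TPlaq P k) (j : ℕ), j < k → g p ≠ 0 →
      ∑ t ∈ range (P.L ^ k), |T t p j| ≤
        (2 * M ^ 2 * (MC * ((P.L : ℝ) ^ (k - j)) ^ (P.d - 2)) * (P.d : ℝ) ^ 2 * K1 * ((P.L : ℝ) ^ k / (P.L : ℝ) ^ j)) *
          (Real.exp (-(a₀ / 3 * ((((P.L : ℝ) ^ k) - 1) / (P.L : ℝ) ^ j))) *
            (2 * (1 + 2 * (P.L : ℝ) ^ j / a₁) * Real.exp (3 * a₁ / 4) * Real.exp (-(a₁ / 2 * distEU P k x₀ p.src)))) := by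
    intro p j hjk hgp
    have hLj : 0 < (P.L : ℝ) ^ j := cast_pow_L_pos' j
    set A : ℝ := 2 * M ^ 2 * (MC * ((P.L : ℝ) ^ (k - j)) ^ (P.d - 2)) * (P.d : ℝ) ^ 2 * K1 * ((P.L : ℝ) ^ k / (P.L : ℝ) ^ j)
      with hA
    set κ : ℝ := (((P.L : ℝ) ^ k) ^ (P.d - 2))⁻¹ with hκ
    set E : ℝ := Real.exp (-(a₀ / 3 * ((((P.L : ℝ) ^ k) - 1) / (P.L : ℝ) ^ j))) with hE
    have hA0 : 0 ≤ A := by rw [hA]; positivity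
    have hκ0 : 0 ≤ κ := by rw [hκ]; positivity
    have hE0 : 0 ≤ E := (Real.exp_pos _).le
    -- split the rate using the far hypothesis
    have hsplit : ∀ t ∈ range (P.L ^ k), ∀ q ∈ (torusEdgeCellsTo P 0 k k (Nat.zero_add k) hd).B p,
        Real.exp (-(a₀ * ((supDist (runSite x₀ μ t) q.src : ℝ) / (P.L : ℝ) ^ j))) ≤
          E * Real.exp (-(a₁ * ((supDist (runSite x₀ μ t) q.src : ℝ) / (P.L : ℝ) ^ j))) := by
      intro t ht q hq
      have hD : (((P.L : ℝ) ^ k) - 1) / (P.L : ℝ) ^ j ≤ (supDist (runSite x₀ μ t) q.src : ℝ) / (P.L : ℝ) ^ j :=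
        div_le_div_of_nonneg_right (hfar p hgp q hq t ht) hLj.le
      have h := exp_split_far (x := (supDist (runSite x₀ μ t) q.src : ℝ) / (P.L : ℝ) ^ j) ha₀p.le hD
      rwa [hE, ha₁]
    -- p09: the line count for one half of `a₁`, the worst bond for the other half
    have hq : ∀ q ∈ (torusEdgeCellsTo P 0 k k (Nat.zero_add k) hd).B p, ∑ t ∈ range (P.L ^ k), Real.exp (-(a₁ * ((supDist (runSite x₀ μ t) q.src : ℝ) / (P.L : ℝ) ^ j))) ≤
        2 * (1 + 2 * (P.L : ℝ) ^ j / a₁) * Real.exp (3 * a₁ / 4) * Real.exp (-(a₁ / 2 * distEU P k x₀ p.src)) := by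
      intro q hq
      calc _ ≤ 2 * (1 + 2 * (P.L : ℝ) ^ j / a₁) *
            Real.exp (-(a₁ / 2 * (max ((supDist x₀ q.src : ℝ) - ((P.L : ℝ) ^ k - 1)) 0 / (P.L : ℝ) ^ k))) :=
            sum_line_exp_le hjk.le hsites ha₁p x₀ μ q.src
        _ ≤ 2 * (1 + 2 * (P.L : ℝ) ^ j / a₁) * (Real.exp (3 * a₁ / 4) * Real.exp (-(a₁ / 2 * distEU P k x₀ p.src))) :=
            mul_le_mul_of_nonneg_left (exp_worst_le hd hk ha₁p x₀ hq) (by positivity)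
        _ = _ := by ring
    have hcardN : ((torusEdgeCellsTo P 0 k k (Nat.zero_add k) hd).B p).card = (P.L ^ k) ^ (P.d - 2) := BIJ85Eq224Base0.card_edgeBTo (Nat.zero_add k) hk hd p
    have hcard : (((torusEdgeCellsTo P 0 k k (Nat.zero_add k) hd).B p).card : ℝ) = ((P.L : ℝ) ^ k) ^ (P.d - 2) := by rw [hcardN]; push_cast; ring
    calc ∑ t ∈ range (P.L ^ k), |T t p j|
        ≤ ∑ t ∈ range (P.L ^ k), A * κ * ∑ q ∈ (torusEdgeCellsTo P 0 k k (Nat.zero_add k) hd).B p, Real.exp (-(a₀ * ((supDist (runSite x₀ μ t) q.src : ℝ) / (P.L : ℝ) ^ j))) :=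
          Finset.sum_le_sum fun t _ => hterm t p j hjk
      _ ≤ ∑ t ∈ range (P.L ^ k), A * κ * ∑ q ∈ (torusEdgeCellsTo P 0 k k (Nat.zero_add k) hd).B p, E * Real.exp (-(a₁ * ((supDist (runSite x₀ μ t) q.src : ℝ) / (P.L : ℝ) ^ j))) :=
          Finset.sum_le_sum fun t ht => mul_le_mul_of_nonneg_left (Finset.sum_le_sum fun q hq => hsplit t ht q hq) (mul_nonneg hA0 hκ0)
      _ = A * κ * E * ∑ q ∈ (torusEdgeCellsTo P 0 k k (Nat.zero_add k) hd).B p, ∑ t ∈ range (P.L ^ k), Real.exp (-(a₁ * ((supDist (runSite x₀ μ t) q.src : ℝ) / (P.L : ℝ) ^ j))) := by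
          rw [Finset.sum_comm]
          simp only [Finset.mul_sum]
          refine Finset.sum_congr rfl fun q _ => Finset.sum_congr rfl fun t _ => by ring
      _ ≤ A * κ * E * ∑ q ∈ (torusEdgeCellsTo P 0 k k (Nat.zero_add k) hd).B p, 2 * (1 + 2 * (P.L : ℝ) ^ j / a₁) * Real.exp (3 * a₁ / 4) * Real.exp (-(a₁ / 2 * distEU P k x₀ p.src)) :=
          mul_le_mul_of_nonneg_left (Finset.sum_le_sum hq) (by positivity)
      _ = A * (κ * ((torusEdgeCellsTo P 0 k k (Nat.zero_add k) hd).B p).card) * (E * (2 * (1 + 2 * (P.L : ℝ) ^ j / a₁) * Real.exp (3 * a₁ / 4) *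
            Real.exp (-(a₁ / 2 * distEU P k x₀ p.src)))) := by rw [Finset.sum_const, nsmul_eq_mul]; ring
      _ = _ := by rw [hcard, hκ, inv_mul_cancel₀ (pow_pos hLk _).ne', mul_one]
  -- per scale j: weights |g p|, sum over p, the factor η (d = 2)
  have hscale : ∀ j ∈ Finset.range k,
      P.eta k * ∑ p : TPlaq P k, ∑ t ∈ range (P.L ^ k), |g p| * |T t p j| ≤ C * Kf * r ^ (k - j) := by
    intro j hj
    have hjk : j < k := Finset.mem_range.1 hj
    have hLj : 0 < (P.L : ℝ) ^ j := cast_pow_L_pos' j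
    have hLj1 : 1 ≤ (P.L : ℝ) ^ j := one_le_pow₀ (by exact_mod_cast P.L_pos)
    have hd0 : P.d - 2 = 0 := by omega
    set Aj : ℝ := 2 * M ^ 2 * (MC * ((P.L : ℝ) ^ (k - j)) ^ (P.d - 2)) * (P.d : ℝ) ^ 2 * K1 * ((P.L : ℝ) ^ k / (P.L : ℝ) ^ j)
      with hAj
    set Ej : ℝ := Real.exp (-(a₀ / 3 * ((((P.L : ℝ) ^ k) - 1) / (P.L : ℝ) ^ j))) with hEj
    set Wj : ℝ := 2 * (1 + 2 * (P.L : ℝ) ^ j / a₁) with hWj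
    have hAj0 : 0 ≤ Aj := by rw [hAj]; positivity
    have hEj0 : 0 ≤ Ej := (Real.exp_pos _).le
    have hWj0 : 0 ≤ Wj := by rw [hWj]; positivity
    -- per p (charged or not)
    have hp : ∀ p : TPlaq P k, ∑ t ∈ range (P.L ^ k), |g p| * |T t p j| ≤
        C * (Aj * Ej * Wj * Real.exp (3 * a₁ / 4) * Real.exp (-(a₁ / 2 * distEU P k x₀ p.src))) := by
      intro p
      by_cases hgp : g p = 0
      · simp only [hgp, abs_zero, zero_mul, Finset.sum_const_zero]
        positivity
      · rw [← Finset.mul_sum]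
        calc |g p| * ∑ t ∈ range (P.L ^ k), |T t p j|
            ≤ C * (Aj * (Ej * (Wj * Real.exp (3 * a₁ / 4) * Real.exp (-(a₁ / 2 * distEU P k x₀ p.src))))) :=
              mul_le_mul (hg p) (hline p j hjk hgp) (Finset.sum_nonneg fun _ _ => abs_nonneg _) hC0
          _ = _ := by ring
    have hS := sum_exp_neg_distEU_le hk (half_pos ha₁p) x₀
    have hsum : ∑ p : TPlaq P k, ∑ t ∈ range (P.L ^ k), |g p| * |T t p j| ≤ C * (Aj * Ej * Wj * Real.exp (3 * a₁ / 4)) * S'' := by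
      calc _ ≤ ∑ p : TPlaq P k, C * (Aj * Ej * Wj * Real.exp (3 * a₁ / 4) * Real.exp (-(a₁ / 2 * distEU P k x₀ p.src))) :=
            Finset.sum_le_sum fun p _ => hp p
        _ = C * (Aj * Ej * Wj * Real.exp (3 * a₁ / 4)) * ∑ p : TPlaq P k, Real.exp (-(a₁ / 2 * distEU P k x₀ p.src)) := by
            rw [Finset.mul_sum]; refine Finset.sum_congr rfl fun p _ => by ring
        _ ≤ C * (Aj * Ej * Wj * Real.exp (3 * a₁ / 4)) *
              ((P.d : ℝ) ^ 2 * ∑ y : TSite P k, Real.exp (-(a₁ / 2 * distEU P k x₀ y))) :=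
            mul_le_mul_of_nonneg_left (sum_plaq_src_le' (fun y => Real.exp (-(a₁ / 2 * distEU P k x₀ y)))
              fun _ => (Real.exp_pos _).le) (by positivity)
        _ ≤ C * (Aj * Ej * Wj * Real.exp (3 * a₁ / 4)) * S'' := by
            rw [hS'']
            exact mul_le_mul_of_nonneg_left (mul_le_mul_of_nonneg_left hS (by positivity)) (by positivity)
    -- η·Aj·Wj ≤ (2M²M_Cd²K1)·W'  (d = 2)
    have hkey : ((P.L : ℝ) ^ k)⁻¹ * ((P.L : ℝ) ^ k / (P.L : ℝ) ^ j) * (2 * (1 + 2 * (P.L : ℝ) ^ j / a₁)) ≤ 2 * (1 + 2 / a₁) := by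
      have hLkne : (P.L : ℝ) ^ k ≠ 0 := hLk.ne'
      have hLjne : (P.L : ℝ) ^ j ≠ 0 := hLj.ne'
      have ha₁ne : a₁ ≠ 0 := ha₁p.ne'
      have e : ((P.L : ℝ) ^ k)⁻¹ * ((P.L : ℝ) ^ k / (P.L : ℝ) ^ j) * (2 * (1 + 2 * (P.L : ℝ) ^ j / a₁)) =
          2 * (((P.L : ℝ) ^ j)⁻¹ + 2 / a₁) := by
        field_simp
      rw [e]
      have : ((P.L : ℝ) ^ j)⁻¹ ≤ 1 := inv_le_one_of_one_le₀ hLj1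
      linarith
    have hηAW : P.eta k * Aj * Wj ≤ 2 * M ^ 2 * MC * (P.d : ℝ) ^ 2 * K1 * W' := by
      rw [hAj, hWj, hd0, pow_zero, mul_one, hηk, hW']
      have hfac : 0 ≤ 2 * M ^ 2 * MC * (P.d : ℝ) ^ 2 * K1 := by positivity
      calc ((P.L : ℝ) ^ k)⁻¹ * (2 * M ^ 2 * MC * (P.d : ℝ) ^ 2 * K1 * ((P.L : ℝ) ^ k / (P.L : ℝ) ^ j)) *
            (2 * (1 + 2 * (P.L : ℝ) ^ j / a₁))
          = (2 * M ^ 2 * MC * (P.d : ℝ) ^ 2 * K1) *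
              (((P.L : ℝ) ^ k)⁻¹ * ((P.L : ℝ) ^ k / (P.L : ℝ) ^ j) * (2 * (1 + 2 * (P.L : ℝ) ^ j / a₁))) := by ring
        _ ≤ (2 * M ^ 2 * MC * (P.d : ℝ) ^ 2 * K1) * (2 * (1 + 2 / a₁)) := mul_le_mul_of_nonneg_left hkey hfac
        _ = _ := by ring
    have hEr : Ej ≤ r ^ (k - j) := by rw [hEj, hr]; exact exp_far_le hjk ha₀p.le
    calc P.eta k * ∑ p : TPlaq P k, ∑ t ∈ range (P.L ^ k), |g p| * |T t p j|
        ≤ P.eta k * (C * (Aj * Ej * Wj * Real.exp (3 * a₁ / 4)) * S'') := mul_le_mul_of_nonneg_left hsum (eta_pos P k).le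
      _ = C * ((P.eta k * Aj * Wj) * Real.exp (3 * a₁ / 4) * S'') * Ej := by ring
      _ ≤ C * ((2 * M ^ 2 * MC * (P.d : ℝ) ^ 2 * K1 * W') * Real.exp (3 * a₁ / 4) * S'') * r ^ (k - j) := by
          refine mul_le_mul (mul_le_mul_of_nonneg_left ?_ hC0) hEr hEj0 (by positivity)
          exact mul_le_mul_of_nonneg_right (mul_le_mul_of_nonneg_right hηAW (Real.exp_pos _).le) (by rw [hS'']; positivity)
      _ = C * Kf * r ^ (k - j) := by rw [hKf]; ring
  -- the geometric sum over the scales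
  have hgeom : ∑ j ∈ Finset.range k, r ^ (k - j) ≤ (1 - r)⁻¹ := by
    calc ∑ j ∈ Finset.range k, r ^ (k - j) ≤ ∑ j ∈ Finset.range k, r ^ (k - 1 - j) :=
          Finset.sum_le_sum fun j hj => pow_le_pow_of_le_one hr0 hr1' (by have := Finset.mem_range.1 hj; omega)
      _ = ∑ j ∈ Finset.range k, r ^ j := Finset.sum_range_reflect (fun j => r ^ j) k
      _ ≤ (1 - r)⁻¹ := geom_sum_le_inv hr0 hr1 k
  -- assemble
  rw [hrepr]
  calc P.eta k * |∑ t ∈ range (P.L ^ k), ∑ p : TPlaq P k, g p * ∑ j ∈ Finset.range k, T t p j|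
      ≤ P.eta k * ∑ t ∈ range (P.L ^ k), ∑ p : TPlaq P k, ∑ j ∈ Finset.range k, |g p| * |T t p j| := by
        refine mul_le_mul_of_nonneg_left ((Finset.abs_sum_le_sum_abs _ _).trans (Finset.sum_le_sum fun t _ =>
          (Finset.abs_sum_le_sum_abs _ _).trans (Finset.sum_le_sum fun p _ => ?_))) (eta_pos P k).le
        rw [abs_mul, ← Finset.mul_sum]
        exact mul_le_mul_of_nonneg_left (Finset.abs_sum_le_sum_abs _ _) (abs_nonneg _)
    _ = ∑ j ∈ Finset.range k, P.eta k * ∑ p : TPlaq P k, ∑ t ∈ range (P.L ^ k), |g p| * |T t p j| := by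
        -- reorder the three sums: (t, p, j) → (j, p, t)
        have e : ∑ t ∈ range (P.L ^ k), ∑ p : TPlaq P k, ∑ j ∈ Finset.range k, |g p| * |T t p j| =
            ∑ j ∈ Finset.range k, ∑ p : TPlaq P k, ∑ t ∈ range (P.L ^ k), |g p| * |T t p j| := by
          calc ∑ t ∈ range (P.L ^ k), ∑ p : TPlaq P k, ∑ j ∈ Finset.range k, |g p| * |T t p j|
              = ∑ t ∈ range (P.L ^ k), ∑ j ∈ Finset.range k, ∑ p : TPlaq P k, |g p| * |T t p j| :=
                Finset.sum_congr rfl fun t _ => Finset.sum_comm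
            _ = ∑ j ∈ Finset.range k, ∑ t ∈ range (P.L ^ k), ∑ p : TPlaq P k, |g p| * |T t p j| := Finset.sum_comm
            _ = _ := Finset.sum_congr rfl fun j _ => Finset.sum_comm
        rw [e, Finset.mul_sum]
    _ ≤ ∑ j ∈ Finset.range k, C * Kf * r ^ (k - j) := Finset.sum_le_sum hscale
    _ = C * Kf * ∑ j ∈ Finset.range k, r ^ (k - j) := by rw [Finset.mul_sum]
    _ ≤ C * Kf * (1 - r)⁻¹ := mul_le_mul_of_nonneg_left hgeom (by positivity)
    _ = Kf * (1 - r)⁻¹ * C := by ring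
    _ = _ := by rw [hKf, hK1, hS'', hW', ha₁, hr, ha₀]

-- ==== PART B

/-! ## §4  The symmetry `S = τ_{2y′_νe_ν} ∘ c_ν` (reflection through the row below the block of `y′`) -/

section Symmetry

open BIJ85TorusReflections BIJ85TkCovariance
open BIJ85SigmaTranslationInvariance (translV translP translV_apply translP_apply)

/-- The unit-lattice vector `y′_νe_ν ∈ T^{(k)}` (half the translation of the symmetry `S`). [cite: BalabanImbrieJaffe1985, Thm. 7.1.1 p.321] -/
def symHalf (_k : ℕ) (ν : Fin P.d) (y' : TSite P _k) : TSite P _k := fun lam => if lam = ν then y' ν else 0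

/-- The unit-lattice translation vector `2y′_νe_ν ∈ T^{(k)}` of the symmetry `S`. [cite: BalabanImbrieJaffe1985, Thm. 7.1.1 p.321] -/
def symVec (k : ℕ) (ν : Fin P.d) (y' : TSite P k) : TSite P k := symHalf k ν y' + symHalf k ν y'

/-- `L^k·(y′_νe_ν) = (L^k·y′)_νe_ν` on `T^{(0)}` (`k ≤ m + K`). [cite: BalabanImbrieJaffe1985, Thm. 7.1.1 p.321] -/
theorem scaleTo_symHalf_apply {k : ℕ} (hk : k ≤ P.m + P.K) (ν : Fin P.d) (y' : TSite P k) (lam : Fin P.d) :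
    Site.scaleTo k (symHalf k ν y') lam = if lam = ν then Site.scaleTo k y' ν else 0 := by
  rw [scaleTo_apply hk, scaleTo_apply hk]
  unfold symHalf
  by_cases h : lam = ν
  · subst h; rw [if_pos rfl, if_pos rfl]
  · rw [if_neg h, if_neg h, ZMod.val_zero, zero_mul, Nat.cast_zero]

/-- `L^k·(2y′_νe_ν) = 2(L^k·y′)_νe_ν` on `T^{(0)}` (`k ≤ m + K`). [cite: BalabanImbrieJaffe1985, Thm. 7.1.1 p.321] -/
theorem scaleTo_symVec_apply {k : ℕ} (hk : k ≤ P.m + P.K) (ν : Fin P.d) (y' : TSite P k) (lam : Fin P.d) :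
    Site.scaleTo k (symVec k ν y') lam = if lam = ν then Site.scaleTo k y' ν + Site.scaleTo k y' ν else 0 := by
  unfold symVec
  rw [map_add, Site.add_apply, scaleTo_symHalf_apply hk]
  split_ifs <;> simp

/-- `(2y′_νe_ν)_λ`. [cite: BalabanImbrieJaffe1985, Thm. 7.1.1 p.321] -/
theorem symVec_apply {k : ℕ} (ν : Fin P.d) (y' : TSite P k) (lam : Fin P.d) :
    symVec k ν y' lam = if lam = ν then y' ν + y' ν else 0 := by
  unfold symVec
  rw [Site.add_apply]
  unfold symHalf
  split_ifs <;> simp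

/-- **`S` maps the row of the line to the row below**: `c_ν(x) + L^k·(2y′_νe_ν) = x − e_ν` for every `x` on the row `x_ν = (L^k·y′)_ν`
(`k ≤ m + K`). [cite: BalabanImbrieJaffe1985, Thm. 7.1.1 p.321] -/
theorem crefl_add_symVec {k : ℕ} (hk : k ≤ P.m + P.K) (ν : Fin P.d) (y' : TSite P k) {x : TSite P 0}
    (hx : x ν = Site.scaleTo k y' ν) : crefl ν x + Site.scaleTo k (symVec k ν y') = x.unshift ν := by
  funext lam
  rw [Site.add_apply, crefl_apply, scaleTo_symVec_apply hk, Site.unshift_apply]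
  by_cases h : lam = ν
  · subst h; rw [if_pos rfl, if_pos rfl, if_pos rfl, hx]; ring
  · rw [if_neg h, if_neg h, if_neg h, add_zero]

/-- **THE LINE SUM OF THE `S`-TRANSFORMED FIELD IS THE LINE SUM ON THE ROW BELOW**: for every bond function `A` on `T^{(0)}`,
`Σ_{t<n}(c_ν τ_v A)(x₀ + te_μ) = Σ_{t<n} A(x₀ − e_ν + te_μ)` (`x₀ = L^k·y′`, `v = L^k·2y′_νe_ν`, `μ ≠ ν`; file 1's `reflV`, g3's `translV`).
[cite: BalabanImbrieJaffe1985, (7.3.2) p.326] -/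
theorem sum_runBond_symm {k : ℕ} (hk : k ≤ P.m + P.K) {μ ν : Fin P.d} (hμν : μ ≠ ν) (y' : TSite P k) (A : VecField P 0 ℝ) (n : ℕ) :
    ∑ t ∈ range n, reflV ν (translV (Site.scaleTo k (symVec k ν y')) A) (runBond (Site.scaleTo k y') μ t) =
      ∑ t ∈ range n, A (runBond ((Site.scaleTo k y').unshift ν) μ t) := by
  refine Finset.sum_congr rfl fun t _ => ?_
  rw [runBond, runBond, reflV_mk_of_ne ν _ _ hμν, translV_apply, PBond.translate,
    crefl_add_symVec hk ν y' (runSite_apply_of_ne _ hμν.symm t), runSite_unshift_of_ne _ hμν]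

/-- **`T_k` INTERTWINES `S`**: `T_k(c_ν τ_{2y′_νe_ν} g) = c_ν τ_{L^k·2y′_νe_ν}(T_kg)` (file 2's `TkF_reflP` ∘ `TkF_translP`; `k ≤ m + K`).
[cite: BalabanImbrieJaffe1985, (7.3.2) p.326] -/
theorem TkF_symm (hd : 2 ≤ P.d) {k : ℕ} (hk : k ≤ P.m + P.K) (ν : Fin P.d) (y' : TSite P k) (g : TPlaq P k → ℝ) :
    TkF P hd ((P.eta k) ^ P.d) (P.eta k) k (reflP ν (translP (symVec k ν y') g)) =
      reflV ν (translV (Site.scaleTo k (symVec k ν y')) (TkF P hd ((P.eta k) ^ P.d) (P.eta k) k g)) := by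
  rw [TkF_reflP hd hk (pow_pos (eta_pos P k) _) (eta_pos P k), TkF_translP hd hk (pow_pos (eta_pos P k) _) (eta_pos P k)]

/-- **`S^*g = −g` ON THE `S`-FIXED PLAQUETTES CONTAINING `ν`**: a unit plaquette `q` of `T^{(k)}` with `ν` among its directions and
`ν`-row `q₋,ν = y′_ν − 1` is mapped to itself by `S` with its orientation reversed, so `(c_ν τ g)(q) = −g(q)` — the symmetrised field
`g + S^*g` VANISHES there. [cite: BalabanImbrieJaffe1985, (2.20) p.305] -/
theorem symm_apply_of_fixed {k : ℕ} (ν : Fin P.d) (y' : TSite P k) (g : TPlaq P k → ℝ) {q : TPlaq P k} (hqν : q.μ = ν ∨ q.ν = ν)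
    (hq : q.src ν = y' ν - 1) : reflP ν (translP (symVec k ν y') g) q = -g q := by
  rw [reflP_apply, if_pos hqν, translP_apply]
  congr 2
  obtain ⟨x, α, β, hαβ⟩ := q
  simp only [preflect, if_pos hqν, Plaq.translate, Plaq.mk.injEq, and_true]
  funext lam
  simp only at hq
  rw [Site.add_apply, crefl_apply, symVec_apply]
  by_cases h : lam = ν
  · rw [if_pos h, if_pos h, Site.shift_apply, if_pos rfl, h, hq]; ring
  · rw [if_neg h, if_neg h, add_zero, Site.shift_apply, if_neg h]

/-- **NEAR SOURCES ARE KILLED BY THE SYMMETRISATION (`d = 2`)**: a unit plaquette `p` charged by `g + S^*g` is not `S`-fixed, hence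
(§2) all its edge plaquettes lie at sup-distance `≥ L^k − 1` from every site of the line through `L^k·y′` (`μ ≠ ν`, `k ≤ m + K`).
[cite: BalabanImbrieJaffe1985, (7.3.2) p.326] -/
theorem far_of_symm_two (hd : 2 ≤ P.d) (hd2 : P.d = 2) {k : ℕ} (hk : k ≤ P.m + P.K) {μ ν : Fin P.d} (hμν : μ ≠ ν) (y' : TSite P k)
    (g : TPlaq P k → ℝ) {p : TPlaq P k} (hp : (g + reflP ν (translP (symVec k ν y') g)) p ≠ 0) {q : TPlaq P 0}
    (hq : q ∈ (torusEdgeCellsTo P 0 k k (Nat.zero_add k) hd).B p) (t : ℕ) :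
    (P.L : ℝ) ^ k - 1 ≤ (supDist (runSite (Site.scaleTo k y') μ t) q.src : ℝ) := by
  have hps : p.src ν ≠ y' ν - 1 := by
    intro h
    apply hp
    rw [Pi.add_apply, symm_apply_of_fixed ν y' g ((dir_eq_or_eq_of_two hd2 p ν).elim (fun e => Or.inl e.symm) fun e => Or.inr e.symm) h,
      add_neg_cancel]
  have h := le_supDist_of_mem_edgeB_two hd hd2 hk y' hμν hps hq t
  have hT : 1 ≤ P.L ^ k := Nat.one_le_pow _ _ P.L_pos
  have h' : (((P.L ^ k - 1 : ℕ)) : ℝ) ≤ (supDist (runSite (Site.scaleTo k y') μ t) q.src : ℝ) := by exact_mod_cast h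
  rw [Nat.cast_sub hT, Nat.cast_pow, Nat.cast_one] at h'
  exact h'

end Symmetry

/-! ## §7  The k-UNIFORM line-sum constant: per torus, and on all two-dimensional tori hypothesis-free -/

section Uniform

open BIJ85TorusReflections BIJ85TkCovariance
open BIJ85SigmaTranslationInvariance (translV translP translV_apply translP_apply)

/-- kernel (`d = 2`): the other direction. [cite: BalabanImbrieJaffe1985, (2.20) p.305] -/
private theorem exists_ne_of_two (hd : 2 ≤ P.d) (μ : Fin P.d) : ∃ ν : Fin P.d, μ ≠ ν := by
  by_cases h : (μ : ℕ) = 0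
  · exact ⟨⟨1, by omega⟩, fun e => by have h1 : (μ : ℕ) = 1 := (by rw [e]); omega⟩
  · exact ⟨⟨0, by omega⟩, fun e => by have h1 : (μ : ℕ) = 0 := (by rw [e]); exact h h1⟩

/-- kernel: `|g + S^*g| ≤ 2·max|g|` (`S^*g` is `±g` at another plaquette). [cite: BalabanImbrieJaffe1985, (2.20) p.305] -/
private theorem abs_symm_add_le {k : ℕ} (ν : Fin P.d) (y' : TSite P k) (g : TPlaq P k → ℝ) {C : ℝ} (hg : ∀ q, |g q| ≤ C)
    (q : TPlaq P k) : |(g + reflP ν (translP (symVec k ν y') g)) q| ≤ 2 * C := by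
  rw [Pi.add_apply, reflP_apply, translP_apply]
  have h1 := hg q
  have h2 := hg ((preflect ν q).translate (symVec k ν y'))
  split_ifs
  · calc _ ≤ |g q| + |-(g ((preflect ν q).translate (symVec k ν y')))| := abs_add_le _ _
      _ ≤ 2 * C := by rw [abs_neg]; linarith
  · calc _ ≤ |g q| + |g ((preflect ν q).translate (symVec k ν y'))| := abs_add_le _ _
      _ ≤ 2 * C := by linarith

/-- **THE k-UNIFORM LINE-SUM BOUND, `d = 2`, GIVEN (7.2.2)–(7.2.3) AND THE RESIDUAL BOUND** (`k ≤ m + K`): for a unit-lattice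
plaquette function `g` with `|g| ≤ C` whose residual field satisfies `|f_k| ≤ K_R√(η^d)·C` (p30/p33: every CLOSED `g`, `K_R` of
`exists_KR_allTori`), and every unit bond `c`, `η·|Σ_{b′⊂c}(T_kg)_{b′}| ≤ K_T·C` with
`K_T = 2K_far + K_∞ + (1 + K_R)/2` INDEPENDENT OF `k` (`K_far`, `K_∞` the explicit constants of §§5–6 in `M, M_C, δ, δ_C`) — the
symmetrisation `2Σ_ℓT_kg = Σ_ℓT_k(g + S^*g) + (Σ_ℓ − Σ_{ℓ⁻})T_kg`, §6 for the first term (near sources killed, §4), §3 for the second.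
[cite: BalabanImbrieJaffe1985, (7.3.2) p.326] -/
theorem eta_abs_lineSumIter_TkF_le_uniform (hd : 2 ≤ P.d) (hd2 : P.d = 2) {k : ℕ} (hk : k ≤ P.m + P.K) {a : ℝ} (ha : 0 < a)
    {δ M δC MC : ℝ} (hδ : 0 < δ) (hδC : 0 < δC) (hMC : 0 ≤ MC)
    (hH : ∀ (j : ℕ) (hj : j ≤ P.m + P.K), j < k → ∀ (μ ν : Fin P.d) (x : TSite P 0) (y : TSite P j),
      |(torusRep P j (deltaAData hj a)).H (x, μ) (y, ν)| ≤ M * Real.exp (-(δ * distEU P j x y)))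
    (hB : ∀ (j : ℕ) (hj : j ≤ P.m + P.K), j < k → ∀ (μ ν : Fin P.d) (x : TSite P 0) (y : TSite P j),
      ‖fun lam : Fin P.d => (P.L : ℝ) ^ j *
          ((torusRep P j (deltaAData hj a)).H (x.shift lam, μ) (y, ν) - (torusRep P j (deltaAData hj a)).H (x, μ) (y, ν))‖ ≤
        M * Real.exp (-(δ * distEU P j x y)))
    (hC : ∀ j < k, ∀ b₁ b₂ : PBond P j, |⟪toEj P j (Pi.single b₁ 1),
      CE P ((P.eta j) ^ P.d) ((P.L : ℝ) ^ j) j (toEj P j (Pi.single b₂ 1))⟫| ≤ MC * Real.exp (-(δC * (supDist b₁.src b₂.src : ℝ))))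
    {KR : ℝ} (g : TPlaq P k → ℝ) {C : ℝ} (hg : ∀ q, |g q| ≤ C)
    (hR : ∀ p : TPlaq P 0, |resE hd ((P.eta k) ^ P.d) (P.eta k)⁻¹ k (toU P k g) p| ≤ KR * Real.sqrt ((P.eta k) ^ P.d) * C)
    (c : PBond P (0 + k)) :
    P.eta k * |lineSumIter (TkF P hd ((P.eta k) ^ P.d) (P.eta k) k g) k c| ≤
      ((2 * M ^ 2 * MC * (P.d : ℝ) ^ 2 * (Real.exp (min δ δC / 2 / 2) * ((2 * (1 + P.d / (min δ δC / 2))) ^ P.d) ^ 2) *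
          (2 * (1 + 2 / (2 * (min δ δC / 2) / 3)) * Real.exp (3 * (2 * (min δ δC / 2) / 3) / 4) *
            ((P.d : ℝ) ^ 2 * (Real.exp ((2 * (min δ δC / 2) / 3) / 2 / 2) *
              (2 * (1 + P.d / ((2 * (min δ δC / 2) / 3) / 2))) ^ P.d))) *
          (1 - Real.exp (-(min δ δC / 2 / 3)))⁻¹) +
        (2 * (2 * M ^ 2 * MC * (P.d : ℝ) ^ 2 * (Real.exp (min δ δC / 2 / 2) * ((2 * (1 + P.d / (min δ δC / 2))) ^ P.d) ^ 2) *
          (Real.exp (min δ δC / 2 / 2) * ((P.d : ℝ) ^ 2 *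
            (Real.exp ((min δ δC / 2) / 2) * (2 * (1 + P.d / (min δ δC / 2))) ^ P.d))))) +
        (1 + KR) / 2) * C := by
  -- names for the constants of §§5–6
  set Kfar : ℝ := 2 * M ^ 2 * MC * (P.d : ℝ) ^ 2 * (Real.exp (min δ δC / 2 / 2) * ((2 * (1 + P.d / (min δ δC / 2))) ^ P.d) ^ 2) *
      (2 * (1 + 2 / (2 * (min δ δC / 2) / 3)) * Real.exp (3 * (2 * (min δ δC / 2) / 3) / 4) *
        ((P.d : ℝ) ^ 2 * (Real.exp ((2 * (min δ δC / 2) / 3) / 2 / 2) *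
          (2 * (1 + P.d / ((2 * (min δ δC / 2) / 3) / 2))) ^ P.d))) *
      (1 - Real.exp (-(min δ δC / 2 / 3)))⁻¹ with hKfar
  set Kinf : ℝ := 2 * (2 * M ^ 2 * MC * (P.d : ℝ) ^ 2 * (Real.exp (min δ δC / 2 / 2) * ((2 * (1 + P.d / (min δ δC / 2))) ^ P.d) ^ 2) *
      (Real.exp (min δ δC / 2 / 2) * ((P.d : ℝ) ^ 2 *
        (Real.exp ((min δ δC / 2) / 2) * (2 * (1 + P.d / (min δ δC / 2))) ^ P.d)))) with hKinf
  have hC0 : 0 ≤ C := nonneg_of_bound' hd hg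
  have hη : 0 < P.eta k := eta_pos P k
  -- the line: x₀ = L^k·y′, direction μ, the other direction ν
  set x₀ : TSite P 0 := cornerIter k c.src with hx₀
  set μ : Fin P.d := c.dir with hμ
  obtain ⟨ν, hμν⟩ := exists_ne_of_two hd μ
  set y' : TSite P k := iterBlockOf k x₀ with hy'
  have hxy : x₀ = Site.scaleTo k y' := by rw [hy', hx₀]; exact cornerIter_eq_scaleTo hk c.src
  set A := TkF P hd ((P.eta k) ^ P.d) (P.eta k) k g with hA
  set gS : TPlaq P k → ℝ := reflP ν (translP (symVec k ν y') g) with hgS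
  rw [lineSumIter_eq_sum_runBond _ k (by omega) c]
  -- the three estimates
  have hinf : ∀ b : PBond P 0, P.eta k * |A b| ≤ Kinf * C := fun b => by
    rw [hA, hKinf]; exact eta_abs_TkF_le_two hd hd2 hk ha hδ hδC hMC hH hB hC g hg b
  have hstrip := eta_abs_strip_le hd hk y' hμν g hC0 hg hR hinf
  have hfar := eta_abs_sum_TkF_far_le_two hd hd2 hk ha hδ hδC hMC hH hB hC (Site.scaleTo k y') μ (g + gS)
    (abs_symm_add_le ν y' g hg) (fun p hp q hq t _ => far_of_symm_two hd hd2 hk hμν y' g hp hq t)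
  -- the symmetrisation identity `2Σ_ℓA = Σ_ℓT_k(g + S^*g) + (Σ_ℓA − Σ_{ℓ⁻}A)`
  have hsymm : ∑ t ∈ range (P.L ^ k), TkF P hd ((P.eta k) ^ P.d) (P.eta k) k (g + gS) (runBond (Site.scaleTo k y') μ t) =
      ∑ t ∈ range (P.L ^ k), A (runBond (Site.scaleTo k y') μ t) +
        ∑ t ∈ range (P.L ^ k), A (runBond ((Site.scaleTo k y').unshift ν) μ t) := by
    rw [map_add, ← hA, hgS, TkF_symm hd hk ν y' g, ← hA, ← sum_runBond_symm hk hμν y' A (P.L ^ k), ← Finset.sum_add_distrib]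
    rfl
  have hid : ∑ t ∈ range (P.L ^ k), A (runBond x₀ μ t) =
      (1 / 2 : ℝ) * (∑ t ∈ range (P.L ^ k), TkF P hd ((P.eta k) ^ P.d) (P.eta k) k (g + gS) (runBond (Site.scaleTo k y') μ t) +
        (∑ t ∈ range (P.L ^ k), A (runBond (Site.scaleTo k y') μ t) -
          ∑ t ∈ range (P.L ^ k), A (runBond ((Site.scaleTo k y').unshift ν) μ t))) := by
    rw [hsymm, hxy]; ring
  show P.eta k * |∑ t ∈ range (P.L ^ k), A (runBond x₀ μ t)| ≤ _
  rw [hid, abs_mul, abs_of_pos (by norm_num : (0 : ℝ) < 1 / 2), ← mul_assoc, mul_comm (P.eta k) (1 / 2), mul_assoc]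
  have h2 : P.eta k * |∑ t ∈ range (P.L ^ k), TkF P hd ((P.eta k) ^ P.d) (P.eta k) k (g + gS) (runBond (Site.scaleTo k y') μ t) +
      (∑ t ∈ range (P.L ^ k), A (runBond (Site.scaleTo k y') μ t) -
        ∑ t ∈ range (P.L ^ k), A (runBond ((Site.scaleTo k y').unshift ν) μ t))| ≤
      Kfar * (2 * C) + (2 * Kinf + 1 + KR) * C := by
    calc _ ≤ P.eta k * (|∑ t ∈ range (P.L ^ k), TkF P hd ((P.eta k) ^ P.d) (P.eta k) k (g + gS) (runBond (Site.scaleTo k y') μ t)| +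
          |∑ t ∈ range (P.L ^ k), A (runBond (Site.scaleTo k y') μ t) -
            ∑ t ∈ range (P.L ^ k), A (runBond ((Site.scaleTo k y').unshift ν) μ t)|) :=
          mul_le_mul_of_nonneg_left (abs_add_le _ _) hη.le
      _ ≤ Kfar * (2 * C) + (2 * Kinf + 1 + KR) * C := by rw [mul_add]; exact add_le_add (by rw [hKfar]; exact hfar) hstrip
  calc (1 / 2 : ℝ) * (P.eta k * |∑ t ∈ range (P.L ^ k), TkF P hd ((P.eta k) ^ P.d) (P.eta k) k (g + gS)
          (runBond (Site.scaleTo k y') μ t) +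
        (∑ t ∈ range (P.L ^ k), A (runBond (Site.scaleTo k y') μ t) -
          ∑ t ∈ range (P.L ^ k), A (runBond ((Site.scaleTo k y').unshift ν) μ t))|)
      ≤ (1 / 2 : ℝ) * (Kfar * (2 * C) + (2 * Kinf + 1 + KR) * C) := mul_le_mul_of_nonneg_left h2 (by norm_num)
    _ = (Kfar + Kinf + (1 + KR) / 2) * C := by ring

/-- kernel (`d = 2`): every unit-lattice plaquette function is closed (there is no unit cube). [cite: BalabanImbrieJaffe1985, §7.3 p.326] -/
theorem isClosedPlaq_of_two (hd2 : P.d = 2) {j : ℕ} (G : TPlaq P j → ℝ) : IsClosedPlaq G := by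
  rw [isClosedPlaq_iff_cube]
  intro x μ ν ρ h1 h2
  exfalso
  have := ρ.isLt
  have h1' : (μ : ℕ) < ν := h1
  have h2' : (ν : ℕ) < ρ := h2
  omega

/-- kernel: weakening a kernel bound to a larger prefactor and a smaller rate (p09). [folklore] -/
private theorem weaken_bound {M₁ M₂ δ₁ δ₂ t v : ℝ} (hM : M₁ ≤ M₂) (hM₂ : 0 ≤ M₂) (hδ : δ₂ ≤ δ₁) (ht : 0 ≤ t)
    (h : v ≤ M₁ * Real.exp (-(δ₁ * t))) : v ≤ M₂ * Real.exp (-(δ₂ * t)) :=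
  h.trans ((mul_le_mul_of_nonneg_right hM (Real.exp_pos _).le).trans
    (mul_le_mul_of_nonneg_left (Real.exp_le_exp.2 (by nlinarith)) hM₂))

/-- kernel: `0 ≤ |x − y|`. [folklore] -/
private theorem distEU_nonneg' {j : ℕ} (x : TSite P 0) (y : TSite P j) : 0 ≤ distEU P j x y := by
  rw [distEU]; positivity

/-- **`K_T` UNIFORM IN `k` FOR ALL TWO-DIMENSIONAL TORI, HYPOTHESIS-FREE**: for every odd `L > 1` there is ONE `K_T ≥ 0` such that on every
torus of the series with `d = 2`, `P.L = L` (any volume exponent `m`, any number of steps `K`), for EVERY scale `k ≤ m + K`, every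
unit-lattice plaquette function `g` with `|g| ≤ C` and every unit bond `c`, `η·|Σ_{b′⊂c}(T_kg)_{b′}| ≤ K_T·C` — §7 fed with the all-tori
members of (7.2.2) (p16/p19: `exists_absH_le_allTori`, `exists_gradB_allTori`; scale `0`: `abs_H_zero_le`), the all-tori (7.2.3)
(`ineq723_CE`) and the all-tori residual bound (p33's `exists_KR_allTori`, [6I] Prop. 1.2 inside; every `g` is closed in `d = 2`).  p11's
`SecClosedIdx.hT` thus holds on every two-dimensional torus with a `k`-INDEPENDENT `K_T` (p09's `exists_KT_linear_allTori`: `K₀·k`).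
[cite: BalabanImbrieJaffe1985, (7.3.2) p.326] -/
theorem exists_KT_uniform_allTori {L : ℕ} (hL : Odd L ∧ 1 < L) :
    ∃ KT : ℝ, 0 ≤ KT ∧ ∀ (P : Params) (hPd : P.d = 2) (hPL : P.L = L) (hd : 2 ≤ P.d) (k : ℕ) (hk : k ≤ P.m + P.K)
      (g : TPlaq P k → ℝ) (C : ℝ), (∀ q, |g q| ≤ C) → ∀ c : PBond P (0 + k),
      P.eta k * |lineSumIter (TkF P hd ((P.eta k) ^ P.d) (P.eta k) k g) k c| ≤ KT * C := by
  obtain ⟨δH, MH, hδH, hMH, hHall⟩ := exists_absH_le_allTori (d := 2) (L := L) (by norm_num) hL one_pos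
  obtain ⟨δB, MB, hδB, hMB, hBall⟩ := exists_gradB_allTori (d := 2) (L := L) (by norm_num) hL one_pos
  obtain ⟨MC, δC, hMC, hδC, hCall⟩ := ineq723_CE 2 L le_rfl
  obtain ⟨KR, hKR, hRall⟩ := exists_KR_allTori (d := 2) (L := L) le_rfl one_pos
  set δ : ℝ := min δH δB with hδdef
  set M : ℝ := max MH MB with hMdef
  have hδ : 0 < δ := lt_min hδH hδB
  have hM1 : 1 ≤ M := hMH.trans (le_max_left _ _)
  have hM0 : 0 ≤ M := zero_le_one.trans hM1
  set a₀ : ℝ := min δ δC / 2 with ha₀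
  have ha₀p : 0 < a₀ := half_pos (lt_min hδ hδC)
  set K1 : ℝ := Real.exp (a₀ / 2) * ((2 * (1 + (2 : ℝ) / a₀)) ^ 2) ^ 2 with hK1
  set Kfar : ℝ := 2 * M ^ 2 * MC * (2 : ℝ) ^ 2 * K1 *
      (2 * (1 + 2 / (2 * a₀ / 3)) * Real.exp (3 * (2 * a₀ / 3) / 4) *
        ((2 : ℝ) ^ 2 * (Real.exp ((2 * a₀ / 3) / 2 / 2) * (2 * (1 + (2 : ℝ) / ((2 * a₀ / 3) / 2))) ^ 2))) *
      (1 - Real.exp (-(a₀ / 3)))⁻¹ with hKfar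
  set Kinf : ℝ := 2 * (2 * M ^ 2 * MC * (2 : ℝ) ^ 2 * K1 *
      (Real.exp (a₀ / 2) * ((2 : ℝ) ^ 2 * (Real.exp (a₀ / 2) * (2 * (1 + (2 : ℝ) / a₀)) ^ 2)))) with hKinf
  have hr : Real.exp (-(a₀ / 3)) < 1 := Real.exp_lt_one_iff.2 (by linarith)
  have hr' : 0 < 1 - Real.exp (-(a₀ / 3)) := by linarith
  refine ⟨Kfar + Kinf + (1 + KR) / 2, by positivity, fun P hPd hPL hd k hk g C hg c => ?_⟩
  have hH : ∀ (j : ℕ) (hj : j ≤ P.m + P.K), j < k → ∀ (μ ν : Fin P.d) (x : TSite P 0) (y : TSite P j),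
      |(torusRep P j (deltaAData hj 1)).H (x, μ) (y, ν)| ≤ M * Real.exp (-(δ * distEU P j x y)) := by
    intro j hj _ μ ν x y
    rcases Nat.eq_zero_or_pos j with hj0 | hjpos
    · subst hj0
      exact abs_H_zero_le hj one_pos hM1 δ μ ν x y
    · exact weaken_bound (le_max_left _ _) hM0 (min_le_left _ _) (distEU_nonneg' x y) (hHall P hPd hPL j hjpos hj μ ν x y)
  have hB : ∀ (j : ℕ) (hj : j ≤ P.m + P.K), j < k → ∀ (μ ν : Fin P.d) (x : TSite P 0) (y : TSite P j),
      ‖fun lam : Fin P.d => (P.L : ℝ) ^ j *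
          ((torusRep P j (deltaAData hj 1)).H (x.shift lam, μ) (y, ν) - (torusRep P j (deltaAData hj 1)).H (x, μ) (y, ν))‖ ≤
        M * Real.exp (-(δ * distEU P j x y)) := by
    intro j hj _ μ ν x y
    exact weaken_bound (le_max_right _ _) hM0 (min_le_right _ _) (distEU_nonneg' x y) (hBall P hPd hPL j hj μ ν x y)
  have hC : ∀ j < k, ∀ b₁ b₂ : PBond P j, |⟪toEj P j (Pi.single b₁ 1),
      CE P ((P.eta j) ^ P.d) ((P.L : ℝ) ^ j) j (toEj P j (Pi.single b₂ 1))⟫| ≤ MC * Real.exp (-(δC * (supDist b₁.src b₂.src : ℝ))) :=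
    fun j hjk b₁ b₂ => hCall P hPd hPL j inferInstance (by omega) b₁ b₂
  have hC0 : 0 ≤ C := nonneg_of_bound' hd hg
  -- the case k = 0 (no residual bound available, none needed)
  rcases Nat.eq_zero_or_pos k with hk0 | hkpos
  · subst hk0
    rw [BIJ85LineSumTkKernel.lineSumIter_TkF_eq hd hk]
    simp only [Finset.range_zero, Finset.sum_empty, mul_zero, Finset.sum_const_zero, abs_zero]
    positivity
  have hR : ∀ p : TPlaq P 0, |resE hd ((P.eta k) ^ P.d) (P.eta k)⁻¹ k (toU P k g) p| ≤ KR * Real.sqrt ((P.eta k) ^ P.d) * C :=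
    fun p => hRall P hPd hPL k hkpos hk g (isClosedPlaq_of_two hPd g) C hC0 hg p
  have h := eta_abs_lineSumIter_TkF_le_uniform hd hPd hk one_pos hδ hδC hMC.le hH hB hC g hg hR c
  simp only [hPd, Nat.cast_ofNat] at h ⊢
  simpa only [hKfar, hKinf, hK1, ha₀] using h

/-- **`SecClosedIdx 2 K_R K_T 𝓅` IS TOTAL OVER THE ACTUAL Sect. 7.3 DATA ON EVERY TWO-DIMENSIONAL TORUS WITH A k-INDEPENDENT `K_T`,
HYPOTHESIS-FREE**: for every odd `L > 1`, `a > 0` and `𝓅` there are ONE `K_R ≥ 1` (p33's `closedIdx_allTori`) and ONE `K_T ≥ 0`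
(`exists_KT_uniform_allTori`) such that every torus `P` with `P.d = 2`, `P.L = L`, every scale `1 ≤ k ≤ m + K`, every `0 < e ≤ 1` with
`e𝓅(e) ≤ ½` and every unit `U(1)` field `v` give an index of p11's `SecClosedIdx 2 K_R K_T 𝓅` — the k-uniform version of p09's
`secClosedIdx_allTori_two` (`K_T = K₀·k` there). [cite: BalabanImbrieJaffe1985, (7.3.1)–(7.3.2) p.326] -/
theorem secClosedIdx_allTori_two_uniform {L : ℕ} (hL : Odd L ∧ 1 < L) {a : ℝ} (ha : 0 < a) (pexp : ℝ) :
    ∃ KR KT : ℝ, 1 ≤ KR ∧ 0 ≤ KT ∧ ∀ (P : Params), P.d = 2 → P.L = L → ∀ (k : ℕ), 1 ≤ k → k ≤ P.m + P.K →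
      ∀ (e : ℝ) (he : 0 < e) (he1 : e ≤ 1) (hsmall : e * (1 + Real.log e⁻¹) ^ pexp ≤ 1 / 2) (v : U1Field P k),
        ∃ i : SecClosedIdx 2 KR KT pexp, i.P = P ∧ i.k = k ∧ i.e = e ∧ HEq i.v v := by
  obtain ⟨KR, hKR, hidx⟩ := closedIdx_allTori (d := 2) (L := L) le_rfl ha pexp
  obtain ⟨KT, hKT, hT⟩ := exists_KT_uniform_allTori hL
  refine ⟨KR, KT, hKR, hKT, fun P hPd hPL k hk1 hk e he he1 hsmall v => ?_⟩
  obtain ⟨i, hP, hk', he', hv⟩ := hidx P hPd hPL k hk1 hk e he he1 hsmall v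
  subst hP hk' he'
  exact ⟨{ toClosedIdx := i, hT := fun g _ C hg c => hT i.P hPd hPL i.hd2 i.k i.hk g C hg c }, rfl, rfl, rfl, hv⟩

end Uniform

end

end Literature.MathematicalPhysics.QuantumFieldTheory.BalabanImbrieJaffe1984to88.BIJ85LineSumReflection
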